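import Literature.Computability.FineGrained.IPRenameLookup
import HarnessLib

/-!
# The renaming machine of Impagliazzo–Paturi's Lemma 2, IV: the pass over a block of the forcing table

Family `fine-grained` (trunk T-CPLX-FINE). Fourth file of the machine half of Impagliazzo–Paturi's Lemma 2 (the named fact
`ipRename_reduceList_computable` of `IPLemma2Assembly.lean`). The evaluator of a substituted
clause `gClause P F c` and of a slice constraint `theta P F i` (`ForcedVariableRenaming.lean`)
must decide, for the `B`-variables of a block, whether they are forced under the current tuple
(`IPRenameTables.lean`: `forcedT`, read off the forcing tables `entries`). This file provides
that inner pass and its specification.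

* Programs: `litEnd` (one lookup per table literal, `allf` |= literal true), `entryEnd`
  (`ft |= pt ∧ all false`, `ff |= pf ∧ all false`), `cntStep`/`ruStep`/`captureStep`/`varEnd`
  (count forced variables in `cntf`, unforced ones before the target position in `ru`, capture
  the target's flags in `gt`/`gf`), `bpBody` (one loop body over the word `wBT` of the block
  table, with a seven-state mode register `md2`: skipping `blk` blocks, pattern flags, literals,
  ignoring the rest), `blockPass`.
* Store family `bpSt` (the sixteen registers of the pass over an arbitrary base store), base
  hypotheses `BpBase`, per-symbol budget `bpK L = 60 (|cbody L| + 1)`.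
* Segment lemmas level by level (`segRuns_bp_bits/literal/lits/entry/entries/var/vars`,
  `segRuns_bp_ignore/skip_inner/skip_block/skip`) against the functional state
  (`eTrue`, `fT`, `fF`, `fr`; `cntfW`, `doneW`, `posW`, `ruW`, `gtW`, `gfW`, `varSt`), and
  **`runs_blockPass`**: started on the block table `zsss` with `blk = i` and `pos = j` ticks, the
  pass ends with `cntf = #forced variables of block i`, `ru = #unforced ones before position j`,
  `gt`/`gf` the forcing flags of variable `j`, within `bpK L · |wBT zsss| + 8` steps.

## References

* R. Impagliazzo, R. Paturi, *On the complexity of k-SAT*, J. Comput. System Sci. 62 (2001)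
  367–375, doi:10.1006/jcss.2000.1727, Lemma 2 (p. 373) and its "Moreover" sentence (the
  reduction is computable within the stated time); pp. 371–372 (`G_x`, `Ψ`, `Θ_i`, `Φ_f`).
  (Not held; acquisition request acq-00143.)
* T. Nipkow, G. Klein, *Concrete Semantics with Isabelle/HOL*, Springer 2014, Ch. 7 (big-step
  reasoning about loops, as in `SymbolPrograms.lean`).
-/

namespace Literature.Computability.FineGrained.IPRenameM

open _root_.Computability Complexity Complexity.ACom Sparsifier IPRename

/-! ### The pass over a block of the block table: programs -/

/-- At the comma closing a literal `(ν, q)` of an entry: look the value of `ν` up in the tuple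
register and raise `allf` ("some literal of the entry is true") if it equals `q`; empty the
probe. [folklore] -/
def litEnd : RProg :=
  lookupVal ;;
  pop (kr KR.val) (fun o => match o with
    | some _ => pop (kr KR.lpol) fun o' => match o' with
        | some (Γ'.bit true) => setFlagG Γ'.blank (kr KR.allf)
        | _ => skip
    | none => pop (kr KR.lpol) fun o' => match o' with
        | some (Γ'.bit false) => setFlagG Γ'.blank (kr KR.allf)
        | _ => skip) ;;
  clear (kr KR.pr)

/-- At the `ket` closing an entry: if all its literals are false, the entry forces the variable
according to its pattern flags (`ft |= pt`, `ff |= pf`); empty `pt`, `pf`, `allf`. [folklore] -/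
def entryEnd : RProg :=
  pop (kr KR.allf) (fun o => match o with
    | some _ => skip
    | none => (pop (kr KR.pt) fun o' => match o' with
        | some (Γ'.bit true) => setFlagG Γ'.blank (kr KR.ft)
        | _ => skip) ;;
      (pop (kr KR.pf) fun o' => match o' with
        | some (Γ'.bit true) => setFlagG Γ'.blank (kr KR.ff)
        | _ => skip)) ;;
  clear (kr KR.pt) ;; clear (kr KR.pf)

/-- `cntf += forced`. [folklore] -/
def cntStep : RProg :=
  ifTop (kr KR.ft) fun o => match o with
    | some _ => push (kr KR.cntf) Γ'.blank
    | none => ifTop (kr KR.ff) fun o' => match o' with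
        | some _ => push (kr KR.cntf) Γ'.blank
        | none => skip

/-- `ru += not forced`. [folklore] -/
def ruStep : RProg :=
  ifTop (kr KR.ft) fun o => match o with
    | some _ => skip
    | none => ifTop (kr KR.ff) fun o' => match o' with
        | some _ => skip
        | none => push (kr KR.ru) Γ'.blank

/-- Capture the forcing flags of the target variable in `gt`, `gf`. [folklore] -/
def captureStep : RProg :=
  (ifTop (kr KR.ft) fun o => match o with
    | some _ => push (kr KR.gt) Γ'.blank
    | none => skip) ;;
  (ifTop (kr KR.ff) fun o => match o with
    | some _ => push (kr KR.gf) Γ'.blank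
    | none => skip)

/-- At the `bra` closing a variable: count it in `cntf` if forced; before the target variable
(`pos` nonempty, `done` down) decrement `pos` and count it in `ru` if unforced; at the target
(`pos` empty, `done` down) capture its flags and raise `done`; empty `ft`, `ff`. [folklore] -/
def varEnd : RProg :=
  pop (kr KR.done) (fun o => match o with
    | some d => push (kr KR.done) d ;; cntStep
    | none => pop (kr KR.pos) fun o' => match o' with
        | some _ => cntStep ;; ruStep
        | none => captureStep ;; push (kr KR.done) Γ'.blank ;; cntStep) ;;
  clear (kr KR.ft) ;; clear (kr KR.ff)

/-- Body of the block pass. The mode register `md2` holds: nothing (variable or entry start),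
`bit false` (first pattern flag read), `bit true` (second pattern flag read), `comma` (literal
start), `ket` (inside a literal), `bra` (skipping the blocks before the wanted one, `blk` of
them), `blank` (past the wanted block: ignore). [folklore] -/
def bpBody (s : Γ') : RProg :=
  pop (kr KR.md2) fun o => match o, s with
    | none, Γ'.bit b => push (kr KR.pt) (Γ'.bit b) ;; push (kr KR.md2) (Γ'.bit false)
    | none, Γ'.bra => varEnd
    | none, Γ'.blank => push (kr KR.md2) Γ'.blank
    | some (Γ'.bit false), Γ'.bit b => push (kr KR.pf) (Γ'.bit b) ;; push (kr KR.md2) (Γ'.bit true)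
    | some (Γ'.bit true), Γ'.comma => push (kr KR.md2) Γ'.comma
    | some Γ'.comma, Γ'.bit q => push (kr KR.lpol) (Γ'.bit q) ;; push (kr KR.md2) Γ'.ket
    | some Γ'.comma, Γ'.ket => entryEnd
    | some Γ'.ket, Γ'.bit d => push (kr KR.pr) (Γ'.bit d) ;; push (kr KR.md2) Γ'.ket
    | some Γ'.ket, Γ'.comma => litEnd ;; push (kr KR.md2) Γ'.comma
    | some Γ'.bra, Γ'.blank => pop (kr KR.blk) fun _ => ifTop (kr KR.blk) fun o' => match o' with
        | some _ => push (kr KR.md2) Γ'.bra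
        | none => skip
    | some Γ'.bra, _ => push (kr KR.md2) Γ'.bra
    | some Γ'.blank, _ => push (kr KR.md2) Γ'.blank
    | _, _ => skip

/-- **The block pass** over the copy `btw` of the block table: skip `blk` blocks, evaluate the
next one (see `bpBody`, `varEnd`), ignore the rest. [folklore] -/
def blockPass : RProg :=
  (ifTop (kr KR.blk) fun o => match o with
    | some _ => push (kr KR.md2) Γ'.bra
    | none => skip) ;;
  loop (kr KR.btw) bpBody ;; clear (kr KR.md2)

/-! ### The pass over a block: the store family -/

/-- The store during the block pass: its registers over an arbitrary base store. [folklore] -/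
def bpSt (S : RStore) (btw md2 pt pf lpol pr allf ft ff gt gf pos done ru cntf val : List Γ') : RStore := fun r =>
  if r = kr KR.btw then btw else
  if r = kr KR.md2 then md2 else
  if r = kr KR.pt then pt else
  if r = kr KR.pf then pf else
  if r = kr KR.lpol then lpol else
  if r = kr KR.pr then pr else
  if r = kr KR.allf then allf else
  if r = kr KR.ft then ft else
  if r = kr KR.ff then ff else
  if r = kr KR.gt then gt else
  if r = kr KR.gf then gf else
  if r = kr KR.pos then pos else
  if r = kr KR.done then done else
  if r = kr KR.ru then ru else
  if r = kr KR.cntf then cntf else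
  if r = kr KR.val then val else
  S r

section BpSt

variable (S : RStore) (btw md2 pt pf lpol pr allf ft ff gt gf pos done ru cntf val w : List Γ')

/-- Reading `btw`. [folklore] -/
@[simp] theorem bpSt_btw : bpSt S btw md2 pt pf lpol pr allf ft ff gt gf pos done ru cntf val (kr KR.btw) = btw := by simp [bpSt]

/-- Reading `md2`. [folklore] -/
@[simp] theorem bpSt_md2 : bpSt S btw md2 pt pf lpol pr allf ft ff gt gf pos done ru cntf val (kr KR.md2) = md2 := by simp [bpSt]

/-- Reading `pt`. [folklore] -/
@[simp] theorem bpSt_pt : bpSt S btw md2 pt pf lpol pr allf ft ff gt gf pos done ru cntf val (kr KR.pt) = pt := by simp [bpSt]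

/-- Reading `pf`. [folklore] -/
@[simp] theorem bpSt_pf : bpSt S btw md2 pt pf lpol pr allf ft ff gt gf pos done ru cntf val (kr KR.pf) = pf := by simp [bpSt]

/-- Reading `lpol`. [folklore] -/
@[simp] theorem bpSt_lpol : bpSt S btw md2 pt pf lpol pr allf ft ff gt gf pos done ru cntf val (kr KR.lpol) = lpol := by simp [bpSt]

/-- Reading `pr`. [folklore] -/
@[simp] theorem bpSt_pr : bpSt S btw md2 pt pf lpol pr allf ft ff gt gf pos done ru cntf val (kr KR.pr) = pr := by simp [bpSt]

/-- Reading `allf`. [folklore] -/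
@[simp] theorem bpSt_allf : bpSt S btw md2 pt pf lpol pr allf ft ff gt gf pos done ru cntf val (kr KR.allf) = allf := by simp [bpSt]

/-- Reading `ft`. [folklore] -/
@[simp] theorem bpSt_ft : bpSt S btw md2 pt pf lpol pr allf ft ff gt gf pos done ru cntf val (kr KR.ft) = ft := by simp [bpSt]

/-- Reading `ff`. [folklore] -/
@[simp] theorem bpSt_ff : bpSt S btw md2 pt pf lpol pr allf ft ff gt gf pos done ru cntf val (kr KR.ff) = ff := by simp [bpSt]

/-- Reading `gt`. [folklore] -/
@[simp] theorem bpSt_gt : bpSt S btw md2 pt pf lpol pr allf ft ff gt gf pos done ru cntf val (kr KR.gt) = gt := by simp [bpSt]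

/-- Reading `gf`. [folklore] -/
@[simp] theorem bpSt_gf : bpSt S btw md2 pt pf lpol pr allf ft ff gt gf pos done ru cntf val (kr KR.gf) = gf := by simp [bpSt]

/-- Reading `pos`. [folklore] -/
@[simp] theorem bpSt_pos : bpSt S btw md2 pt pf lpol pr allf ft ff gt gf pos done ru cntf val (kr KR.pos) = pos := by simp [bpSt]

/-- Reading `done`. [folklore] -/
@[simp] theorem bpSt_done : bpSt S btw md2 pt pf lpol pr allf ft ff gt gf pos done ru cntf val (kr KR.done) = done := by simp [bpSt]

/-- Reading `ru`. [folklore] -/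
@[simp] theorem bpSt_ru : bpSt S btw md2 pt pf lpol pr allf ft ff gt gf pos done ru cntf val (kr KR.ru) = ru := by simp [bpSt]

/-- Reading `cntf`. [folklore] -/
@[simp] theorem bpSt_cntf : bpSt S btw md2 pt pf lpol pr allf ft ff gt gf pos done ru cntf val (kr KR.cntf) = cntf := by simp [bpSt]

/-- Reading `val`. [folklore] -/
@[simp] theorem bpSt_val : bpSt S btw md2 pt pf lpol pr allf ft ff gt gf pos done ru cntf val (kr KR.val) = val := by simp [bpSt]

/-- Reading any other register. [folklore] -/
theorem bpSt_other {r : Reg} (h0 : r ≠ kr KR.btw) (h1 : r ≠ kr KR.md2) (h2 : r ≠ kr KR.pt) (h3 : r ≠ kr KR.pf) (h4 : r ≠ kr KR.lpol) (h5 : r ≠ kr KR.pr) (h6 : r ≠ kr KR.allf) (h7 : r ≠ kr KR.ft) (h8 : r ≠ kr KR.ff) (h9 : r ≠ kr KR.gt) (h10 : r ≠ kr KR.gf) (h11 : r ≠ kr KR.pos) (h12 : r ≠ kr KR.done) (h13 : r ≠ kr KR.ru) (h14 : r ≠ kr KR.cntf) (h15 : r ≠ kr KR.val) :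
    bpSt S btw md2 pt pf lpol pr allf ft ff gt gf pos done ru cntf val r = S r := by
  simp [bpSt, h0, h1, h2, h3, h4, h5, h6, h7, h8, h9, h10, h11, h12, h13, h14, h15]

/-- Reading `vw`. [folklore] -/
@[simp] theorem bpSt_vw : bpSt S btw md2 pt pf lpol pr allf ft ff gt gf pos done ru cntf val (kr KR.vw) = S (kr KR.vw) := by simp [bpSt]

/-- Reading `fnd`. [folklore] -/
@[simp] theorem bpSt_fnd : bpSt S btw md2 pt pf lpol pr allf ft ff gt gf pos done ru cntf val (kr KR.fnd) = S (kr KR.fnd) := by simp [bpSt]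

/-- Reading `ex`. [folklore] -/
@[simp] theorem bpSt_ex : bpSt S btw md2 pt pf lpol pr allf ft ff gt gf pos done ru cntf val (kr KR.ex) = S (kr KR.ex) := by simp [bpSt]

/-- Reading `eb`. [folklore] -/
@[simp] theorem bpSt_eb : bpSt S btw md2 pt pf lpol pr allf ft ff gt gf pos done ru cntf val (kr KR.eb) = S (kr KR.eb) := by simp [bpSt]

/-- Reading `lmd`. [folklore] -/
@[simp] theorem bpSt_lmd : bpSt S btw md2 pt pf lpol pr allf ft ff gt gf pos done ru cntf val (kr KR.lmd) = S (kr KR.lmd) := by simp [bpSt]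

/-- Reading `ne`. [folklore] -/
@[simp] theorem bpSt_ne : bpSt S btw md2 pt pf lpol pr allf ft ff gt gf pos done ru cntf val (kr KR.ne) = S (kr KR.ne) := by simp [bpSt]

/-- Reading `x2`. [folklore] -/
@[simp] theorem bpSt_x2 : bpSt S btw md2 pt pf lpol pr allf ft ff gt gf pos done ru cntf val (kr KR.x2) = S (kr KR.x2) := by simp [bpSt]

/-- Reading `t1`. [folklore] -/
@[simp] theorem bpSt_t1 : bpSt S btw md2 pt pf lpol pr allf ft ff gt gf pos done ru cntf val (kr KR.t1) = S (kr KR.t1) := by simp [bpSt]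

/-- Reading `t2`. [folklore] -/
@[simp] theorem bpSt_t2 : bpSt S btw md2 pt pf lpol pr allf ft ff gt gf pos done ru cntf val (kr KR.t2) = S (kr KR.t2) := by simp [bpSt]

/-- Reading `blk`. [folklore] -/
@[simp] theorem bpSt_blk : bpSt S btw md2 pt pf lpol pr allf ft ff gt gf pos done ru cntf val (kr KR.blk) = S (kr KR.blk) := by simp [bpSt]

/-- Reading `iu2`. [folklore] -/
@[simp] theorem bpSt_iu2 : bpSt S btw md2 pt pf lpol pr allf ft ff gt gf pos done ru cntf val (kr KR.iu2) = S (kr KR.iu2) := by simp [bpSt]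

/-- Reading `ytw`. [folklore] -/
@[simp] theorem bpSt_ytw : bpSt S btw md2 pt pf lpol pr allf ft ff gt gf pos done ru cntf val (kr KR.ytw) = S (kr KR.ytw) := by simp [bpSt]

/-- Reading `vt`. [folklore] -/
@[simp] theorem bpSt_vt : bpSt S btw md2 pt pf lpol pr allf ft ff gt gf pos done ru cntf val (tb TB.vt) = S (tb TB.vt) := by simp [bpSt]

/-- Updating `btw`. [folklore] -/
@[simp] theorem update_bpSt_btw :
    Function.update (bpSt S btw md2 pt pf lpol pr allf ft ff gt gf pos done ru cntf val) (kr KR.btw) w = bpSt S w md2 pt pf lpol pr allf ft ff gt gf pos done ru cntf val := by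
  funext r; by_cases h : r = kr KR.btw
  · subst h; simp
  · rw [Function.update_of_ne h]; simp [bpSt, h]

/-- Updating `md2`. [folklore] -/
@[simp] theorem update_bpSt_md2 :
    Function.update (bpSt S btw md2 pt pf lpol pr allf ft ff gt gf pos done ru cntf val) (kr KR.md2) w = bpSt S btw w pt pf lpol pr allf ft ff gt gf pos done ru cntf val := by
  funext r; by_cases h : r = kr KR.md2
  · subst h; simp
  · rw [Function.update_of_ne h]; simp [bpSt, h]

/-- Updating `pt`. [folklore] -/
@[simp] theorem update_bpSt_pt :
    Function.update (bpSt S btw md2 pt pf lpol pr allf ft ff gt gf pos done ru cntf val) (kr KR.pt) w = bpSt S btw md2 w pf lpol pr allf ft ff gt gf pos done ru cntf val := by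
  funext r; by_cases h : r = kr KR.pt
  · subst h; simp
  · rw [Function.update_of_ne h]; simp [bpSt, h]

/-- Updating `pf`. [folklore] -/
@[simp] theorem update_bpSt_pf :
    Function.update (bpSt S btw md2 pt pf lpol pr allf ft ff gt gf pos done ru cntf val) (kr KR.pf) w = bpSt S btw md2 pt w lpol pr allf ft ff gt gf pos done ru cntf val := by
  funext r; by_cases h : r = kr KR.pf
  · subst h; simp
  · rw [Function.update_of_ne h]; simp [bpSt, h]

/-- Updating `lpol`. [folklore] -/
@[simp] theorem update_bpSt_lpol :
    Function.update (bpSt S btw md2 pt pf lpol pr allf ft ff gt gf pos done ru cntf val) (kr KR.lpol) w = bpSt S btw md2 pt pf w pr allf ft ff gt gf pos done ru cntf val := by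
  funext r; by_cases h : r = kr KR.lpol
  · subst h; simp
  · rw [Function.update_of_ne h]; simp [bpSt, h]

/-- Updating `pr`. [folklore] -/
@[simp] theorem update_bpSt_pr :
    Function.update (bpSt S btw md2 pt pf lpol pr allf ft ff gt gf pos done ru cntf val) (kr KR.pr) w = bpSt S btw md2 pt pf lpol w allf ft ff gt gf pos done ru cntf val := by
  funext r; by_cases h : r = kr KR.pr
  · subst h; simp
  · rw [Function.update_of_ne h]; simp [bpSt, h]

/-- Updating `allf`. [folklore] -/
@[simp] theorem update_bpSt_allf :
    Function.update (bpSt S btw md2 pt pf lpol pr allf ft ff gt gf pos done ru cntf val) (kr KR.allf) w = bpSt S btw md2 pt pf lpol pr w ft ff gt gf pos done ru cntf val := by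
  funext r; by_cases h : r = kr KR.allf
  · subst h; simp
  · rw [Function.update_of_ne h]; simp [bpSt, h]

/-- Updating `ft`. [folklore] -/
@[simp] theorem update_bpSt_ft :
    Function.update (bpSt S btw md2 pt pf lpol pr allf ft ff gt gf pos done ru cntf val) (kr KR.ft) w = bpSt S btw md2 pt pf lpol pr allf w ff gt gf pos done ru cntf val := by
  funext r; by_cases h : r = kr KR.ft
  · subst h; simp
  · rw [Function.update_of_ne h]; simp [bpSt, h]

/-- Updating `ff`. [folklore] -/
@[simp] theorem update_bpSt_ff :
    Function.update (bpSt S btw md2 pt pf lpol pr allf ft ff gt gf pos done ru cntf val) (kr KR.ff) w = bpSt S btw md2 pt pf lpol pr allf ft w gt gf pos done ru cntf val := by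
  funext r; by_cases h : r = kr KR.ff
  · subst h; simp
  · rw [Function.update_of_ne h]; simp [bpSt, h]

/-- Updating `gt`. [folklore] -/
@[simp] theorem update_bpSt_gt :
    Function.update (bpSt S btw md2 pt pf lpol pr allf ft ff gt gf pos done ru cntf val) (kr KR.gt) w = bpSt S btw md2 pt pf lpol pr allf ft ff w gf pos done ru cntf val := by
  funext r; by_cases h : r = kr KR.gt
  · subst h; simp
  · rw [Function.update_of_ne h]; simp [bpSt, h]

/-- Updating `gf`. [folklore] -/
@[simp] theorem update_bpSt_gf :
    Function.update (bpSt S btw md2 pt pf lpol pr allf ft ff gt gf pos done ru cntf val) (kr KR.gf) w = bpSt S btw md2 pt pf lpol pr allf ft ff gt w pos done ru cntf val := by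
  funext r; by_cases h : r = kr KR.gf
  · subst h; simp
  · rw [Function.update_of_ne h]; simp [bpSt, h]

/-- Updating `pos`. [folklore] -/
@[simp] theorem update_bpSt_pos :
    Function.update (bpSt S btw md2 pt pf lpol pr allf ft ff gt gf pos done ru cntf val) (kr KR.pos) w = bpSt S btw md2 pt pf lpol pr allf ft ff gt gf w done ru cntf val := by
  funext r; by_cases h : r = kr KR.pos
  · subst h; simp
  · rw [Function.update_of_ne h]; simp [bpSt, h]

/-- Updating `done`. [folklore] -/
@[simp] theorem update_bpSt_done :
    Function.update (bpSt S btw md2 pt pf lpol pr allf ft ff gt gf pos done ru cntf val) (kr KR.done) w = bpSt S btw md2 pt pf lpol pr allf ft ff gt gf pos w ru cntf val := by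
  funext r; by_cases h : r = kr KR.done
  · subst h; simp
  · rw [Function.update_of_ne h]; simp [bpSt, h]

/-- Updating `ru`. [folklore] -/
@[simp] theorem update_bpSt_ru :
    Function.update (bpSt S btw md2 pt pf lpol pr allf ft ff gt gf pos done ru cntf val) (kr KR.ru) w = bpSt S btw md2 pt pf lpol pr allf ft ff gt gf pos done w cntf val := by
  funext r; by_cases h : r = kr KR.ru
  · subst h; simp
  · rw [Function.update_of_ne h]; simp [bpSt, h]

/-- Updating `cntf`. [folklore] -/
@[simp] theorem update_bpSt_cntf :
    Function.update (bpSt S btw md2 pt pf lpol pr allf ft ff gt gf pos done ru cntf val) (kr KR.cntf) w = bpSt S btw md2 pt pf lpol pr allf ft ff gt gf pos done ru w val := by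
  funext r; by_cases h : r = kr KR.cntf
  · subst h; simp
  · rw [Function.update_of_ne h]; simp [bpSt, h]

/-- Updating `val`. [folklore] -/
@[simp] theorem update_bpSt_val :
    Function.update (bpSt S btw md2 pt pf lpol pr allf ft ff gt gf pos done ru cntf val) (kr KR.val) w = bpSt S btw md2 pt pf lpol pr allf ft ff gt gf pos done ru cntf w := by
  funext r; by_cases h : r = kr KR.val
  · subst h; simp
  · rw [Function.update_of_ne h]; simp [bpSt, h]

/-- Updating a register outside the family commutes with it. [folklore] -/
theorem update_bpSt_of_other {r : Reg} (h0 : r ≠ kr KR.btw) (h1 : r ≠ kr KR.md2) (h2 : r ≠ kr KR.pt) (h3 : r ≠ kr KR.pf) (h4 : r ≠ kr KR.lpol) (h5 : r ≠ kr KR.pr) (h6 : r ≠ kr KR.allf) (h7 : r ≠ kr KR.ft) (h8 : r ≠ kr KR.ff) (h9 : r ≠ kr KR.gt) (h10 : r ≠ kr KR.gf) (h11 : r ≠ kr KR.pos) (h12 : r ≠ kr KR.done) (h13 : r ≠ kr KR.ru) (h14 : r ≠ kr KR.cntf) (h15 : r ≠ kr KR.val) (u : List Γ') :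
    Function.update (bpSt S btw md2 pt pf lpol pr allf ft ff gt gf pos done ru cntf val) r u = bpSt (Function.update S r u) btw md2 pt pf lpol pr allf ft ff gt gf pos done ru cntf val := by
  funext r'
  by_cases h : r' = r
  · subst h; simp [bpSt, h0, h1, h2, h3, h4, h5, h6, h7, h8, h9, h10, h11, h12, h13, h14, h15]
  · rw [Function.update_of_ne h]
    simp only [bpSt, Function.update_of_ne h]

end BpSt

/-! ### The pass over a block: specifications -/

/-- What the block pass needs of the base store: the tuple register holds the literal list `L`
and the scratch registers of the lookup are empty. [folklore] -/
structure BpBase (S : RStore) (L : List Lit) : Prop where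
  /-- the tuple register -/
  vt : S (tb TB.vt) = cbody L
  /-- scratch -/
  vw : S (kr KR.vw) = []
  /-- scratch -/
  fnd : S (kr KR.fnd) = []
  /-- scratch -/
  ex : S (kr KR.ex) = []
  /-- scratch -/
  eb : S (kr KR.eb) = []
  /-- scratch -/
  lmd : S (kr KR.lmd) = []
  /-- scratch -/
  ne : S (kr KR.ne) = []
  /-- scratch -/
  x2 : S (kr KR.x2) = []
  /-- scratch -/
  t1 : S (kr KR.t1) = []
  /-- scratch -/
  t2 : S (kr KR.t2) = []

/-- The per-symbol budget of the block pass: every symbol of the block table costs at most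
`60 (|cbody L| + 1)` steps (the lookups dominate). [folklore] -/
def bpK (L : List Lit) : ℕ := 60 * ((cbody L).length + 1)

section Literal

variable (S : RStore) (L : List Lit) (hB : BpBase S L)
include hB

/-- **`litEnd`** after the literal `(ν, q)`: `allf` records whether some literal so far is true
under the tuple. [folklore] -/
theorem runs_litEnd (ν : ℕ) (q : Bool) (btw md2 pt pf ft ff gt gf pos done ru cntf : List Γ')
    (a : Prop) [Decidable a] :
    Runs litEnd (bpSt S btw md2 pt pf [Γ'.bit q] (rbits ν) (flagW Γ'.blank a) ft ff gt gf pos done ru cntf [])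
      (bpSt S btw md2 pt pf [] [] (flagW Γ'.blank (a ∨ lookupB L ν = q)) ft ff gt gf pos done ru cntf [])
      ((12 * (rbits ν).length + 46) * (cbody L).length + 2 * (rbits ν).length + 19) := by
  unfold litEnd
  set R := bpSt S btw md2 pt pf [Γ'.bit q] (rbits ν) (flagW Γ'.blank a) ft ff gt gf pos done ru cntf []
    with hR
  have h1 := runs_lookupVal R ν L (by simp [hR]) (by simp [hR, hB.vt]) (by simp [hR, hB.vw])
    (by simp [hR, hB.fnd]) (by simp [hR]) (by simp [hR, hB.ex]) (by simp [hR, hB.eb])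
    (by simp [hR, hB.lmd]) (by simp [hR, hB.ne]) (by simp [hR, hB.x2]) (by simp [hR, hB.t1])
    (by simp [hR, hB.t2])
  rw [hR, update_bpSt_val] at h1
  have hfl : (flagW Γ'.blank a).length ≤ 1 := length_flagW_le _ _
  -- the test
  have h2 : Runs (pop (kr KR.val) (fun o => match o with
      | some _ => pop (kr KR.lpol) fun o' => match o' with
          | some (Γ'.bit true) => setFlagG Γ'.blank (kr KR.allf)
          | _ => skip
      | none => pop (kr KR.lpol) fun o' => match o' with
          | some (Γ'.bit false) => setFlagG Γ'.blank (kr KR.allf)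
          | _ => skip))
      (bpSt S btw md2 pt pf [Γ'.bit q] (rbits ν) (flagW Γ'.blank a) ft ff gt gf pos done ru cntf
        (flagW Γ'.blank (lookupB L ν = true)))
      (bpSt S btw md2 pt pf [] (rbits ν) (flagW Γ'.blank (a ∨ lookupB L ν = q)) ft ff gt gf pos done ru cntf [])
      (4 + 2 + 2) := by
    by_cases hv : lookupB L ν = true
    · rw [flagW_true _ hv]
      refine Runs.pop_cons (k := kr KR.val) (a := Γ'.blank) (w := []) (by simp) ?_
      rw [update_bpSt_val]
      refine Runs.pop_cons (k := kr KR.lpol) (a := Γ'.bit q) (w := []) (by simp) ?_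
      rw [update_bpSt_lpol]
      cases q with
      | true =>
        have hor : a ∨ lookupB L ν = true := Or.inr hv
        rw [flagW_true _ hor]
        exact (runs_setFlagG Γ'.blank (kr KR.allf) _ (by simpa using hfl)).of_eq (by simp) le_rfl
      | false =>
        have hiff : (a ∨ lookupB L ν = false) ↔ a := by simp [hv]
        rw [flagW_congr _ hiff]
        exact (Runs.skip _).mono (by norm_num)
    · rw [flagW_false _ hv]
      refine Runs.pop_nil (by simp) ?_
      have inner : Runs (pop (kr KR.lpol) fun o' => match o' with
          | some (Γ'.bit false) => setFlagG Γ'.blank (kr KR.allf)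
          | _ => skip)
          (bpSt S btw md2 pt pf [Γ'.bit q] (rbits ν) (flagW Γ'.blank a) ft ff gt gf pos done ru cntf [])
          (bpSt S btw md2 pt pf [] (rbits ν) (flagW Γ'.blank (a ∨ lookupB L ν = q)) ft ff gt gf pos done
            ru cntf []) (4 + 2) := by
        refine Runs.pop_cons (k := kr KR.lpol) (a := Γ'.bit q) (w := []) (by simp) ?_
        rw [update_bpSt_lpol]
        cases q with
        | false =>
          have hor : a ∨ lookupB L ν = false := Or.inr (by simpa using hv)
          rw [flagW_true _ hor]
          exact (runs_setFlagG Γ'.blank (kr KR.allf) _ (by simpa using hfl)).of_eq (by simp) le_rfl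
        | true =>
          have hiff : (a ∨ lookupB L ν = true) ↔ a := by simp [hv]
          rw [flagW_congr _ hiff]
          exact (Runs.skip _).mono (by norm_num)
      exact inner.mono (by norm_num)
  have h3 := runs_clear (kr KR.pr)
    (bpSt S btw md2 pt pf [] (rbits ν) (flagW Γ'.blank (a ∨ lookupB L ν = q)) ft ff gt gf pos done ru cntf [])
  rw [bpSt_pr, update_bpSt_pr] at h3
  exact (h1.seq (h2.seq h3)).mono (by omega)

end Literal

/-- Arithmetic of the literal budget. [folklore] -/
theorem litCost_le (b c : ℕ) : (12 * b + 46) * c + 8 * b + 28 + 2 ≤ 60 * (c + 1) * (b + 2) := by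
  nlinarith [Nat.zero_le (b * c), Nat.zero_le b, Nat.zero_le c]

section Literal2

variable (S : RStore) (L : List Lit) (hB : BpBase S L)
include hB

omit hB in
/-- Inside a literal of an entry (mode `ket`), index bits are collected in `pr`. [folklore] -/
theorem segRuns_bp_bits (pt pf lpol allf ft ff gt gf pos done ru cntf : List Γ') :
    ∀ (u : List Bool) (rest pr : List Γ'),
      SegRuns (kr KR.btw) bpBody (u.map Γ'.bit)
        (bpSt S (u.map Γ'.bit ++ rest) [Γ'.ket] pt pf lpol pr allf ft ff gt gf pos done ru cntf [])
        (bpSt S rest [Γ'.ket] pt pf lpol ((u.map Γ'.bit).reverse ++ pr) allf ft ff gt gf pos done ru cntf [])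
        (6 * u.length)
  | [], rest, pr => by simpa using SegRuns.nil (kr KR.btw) bpBody _
  | d :: u, rest, pr => by
    have hbody : Runs (bpBody (Γ'.bit d))
        (Function.update (bpSt S (Γ'.bit d :: (u.map Γ'.bit ++ rest)) [Γ'.ket] pt pf lpol pr allf ft ff gt gf
          pos done ru cntf []) (kr KR.btw) (u.map Γ'.bit ++ rest))
        (bpSt S (u.map Γ'.bit ++ rest) [Γ'.ket] pt pf lpol (Γ'.bit d :: pr) allf ft ff gt gf pos done ru cntf [])
        (2 + 2) := by
      rw [update_bpSt_btw]
      unfold bpBody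
      refine Runs.pop_cons (k := kr KR.md2) (a := Γ'.ket) (w := []) (by simp) ?_
      rw [update_bpSt_md2]
      exact ((Runs.push' (R' := bpSt S (u.map Γ'.bit ++ rest) [] pt pf lpol (Γ'.bit d :: pr) allf ft ff gt
        gf pos done ru cntf []) (by simp)).seq (Runs.push' (by simp))).of_eq rfl (by norm_num)
    have ih := segRuns_bp_bits pt pf lpol allf ft ff gt gf pos done ru cntf u rest (Γ'.bit d :: pr)
    have hk : bpSt S (Γ'.bit d :: (u.map Γ'.bit ++ rest)) [Γ'.ket] pt pf lpol pr allf ft ff gt gf pos done ru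
        cntf [] (kr KR.btw) = Γ'.bit d :: (u.map Γ'.bit ++ rest) := by simp
    refine (SegRuns.cons hk hbody ih).cast (by simp) (by simp) (by simp) ?_
    simp only [List.length_cons]; omega

/-- **One literal of an entry** (mode `comma` before and after). [folklore] -/
theorem segRuns_bp_literal (ν : ℕ) (q : Bool) (rest pt pf ft ff gt gf pos done ru cntf : List Γ')
    (a : Prop) [Decidable a] :
    SegRuns (kr KR.btw) bpBody (KCNF.encodeLiteral (ν, q))
      (bpSt S (KCNF.encodeLiteral (ν, q) ++ rest) [Γ'.comma] pt pf [] [] (flagW Γ'.blank a) ft ff gt gf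
        pos done ru cntf [])
      (bpSt S rest [Γ'.comma] pt pf [] [] (flagW Γ'.blank (a ∨ lookupB L ν = q)) ft ff gt gf
        pos done ru cntf [])
      (bpK L * (KCNF.encodeLiteral (ν, q)).length) := by
  have hlit : KCNF.encodeLiteral (ν, q) = Γ'.bit q :: ((encodeNat ν).map Γ'.bit ++ [Γ'.comma]) := rfl
  rw [hlit]
  set u := (encodeNat ν).map Γ'.bit with hu
  -- the polarity bit
  have h1 : Runs (bpBody (Γ'.bit q))
      (Function.update (bpSt S (Γ'.bit q :: (u ++ [Γ'.comma]) ++ rest) [Γ'.comma] pt pf [] []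
        (flagW Γ'.blank a) ft ff gt gf pos done ru cntf []) (kr KR.btw) (u ++ [Γ'.comma] ++ rest))
      (bpSt S (u ++ [Γ'.comma] ++ rest) [Γ'.ket] pt pf [Γ'.bit q] [] (flagW Γ'.blank a) ft ff gt gf
        pos done ru cntf []) (2 + 2) := by
    rw [update_bpSt_btw]
    unfold bpBody
    refine Runs.pop_cons (k := kr KR.md2) (a := Γ'.comma) (w := []) (by simp) ?_
    rw [update_bpSt_md2]
    exact ((Runs.push' (R' := bpSt S (u ++ [Γ'.comma] ++ rest) [] pt pf [Γ'.bit q] [] (flagW Γ'.blank a)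
      ft ff gt gf pos done ru cntf []) (by simp)).seq (Runs.push' (by simp))).of_eq rfl (by norm_num)
  -- the index bits
  have h2 := segRuns_bp_bits S pt pf [Γ'.bit q] (flagW Γ'.blank a) ft ff gt gf pos done ru cntf
    (encodeNat ν) ([Γ'.comma] ++ rest) []
  rw [← hu, List.append_nil] at h2
  have hrb : u.reverse = rbits ν := by rw [hu, rbits]
  rw [hrb] at h2
  -- the comma
  have h3 : Runs (bpBody Γ'.comma)
      (Function.update (bpSt S ([Γ'.comma] ++ rest) [Γ'.ket] pt pf [Γ'.bit q] (rbits ν) (flagW Γ'.blank a)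
        ft ff gt gf pos done ru cntf []) (kr KR.btw) rest)
      (bpSt S rest [Γ'.comma] pt pf [] [] (flagW Γ'.blank (a ∨ lookupB L ν = q)) ft ff gt gf
        pos done ru cntf [])
      ((12 * (rbits ν).length + 46) * (cbody L).length + 2 * (rbits ν).length + 19 + 1 + 2) := by
    rw [update_bpSt_btw]
    unfold bpBody
    refine Runs.pop_cons (k := kr KR.md2) (a := Γ'.ket) (w := []) (by simp) ?_
    rw [update_bpSt_md2]
    exact (runs_litEnd S L hB ν q rest [] pt pf ft ff gt gf pos done ru cntf a).seq (Runs.push' (by simp))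
  have hk1 : bpSt S (Γ'.bit q :: (u ++ [Γ'.comma]) ++ rest) [Γ'.comma] pt pf [] [] (flagW Γ'.blank a) ft ff
      gt gf pos done ru cntf [] (kr KR.btw) = Γ'.bit q :: (u ++ [Γ'.comma] ++ rest) := by simp
  have hk3 : bpSt S ([Γ'.comma] ++ rest) [Γ'.ket] pt pf [Γ'.bit q] (rbits ν) (flagW Γ'.blank a) ft ff gt gf
      pos done ru cntf [] (kr KR.btw) = Γ'.comma :: rest := by simp
  have h23 := h2.append (SegRuns.single hk3 h3)
  have := SegRuns.cons hk1 h1 (h23.cast rfl (by simp) rfl le_rfl)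
  refine this.cast (by simp) rfl rfl ?_
  have hr : (rbits ν).length = u.length := by simp [rbits, hu]
  have hu' : u.length = (encodeNat ν).length := by simp [hu]
  have := litCost_le (rbits ν).length (cbody L).length
  simp only [List.length_cons, List.length_append, List.length_nil, bpK]
  rw [hr] at this ⊢
  rw [hu'] at this ⊢
  nlinarith [this]

/-- **The literals of an entry**: `allf` ends up recording whether some literal is true under the
tuple. [folklore] -/
theorem segRuns_bp_lits (pt pf ft ff gt gf pos done ru cntf : List Γ') :
    ∀ (ls₂ ls₁ : List Lit) (rest : List Γ'),
      SegRuns (kr KR.btw) bpBody (cbody ls₂)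
        (bpSt S (cbody ls₂ ++ rest) [Γ'.comma] pt pf [] []
          (flagW Γ'.blank (∃ l ∈ ls₁, lookupB L l.1 = l.2)) ft ff gt gf pos done ru cntf [])
        (bpSt S rest [Γ'.comma] pt pf [] []
          (flagW Γ'.blank (∃ l ∈ ls₁ ++ ls₂, lookupB L l.1 = l.2)) ft ff gt gf pos done ru cntf [])
        (bpK L * (cbody ls₂).length)
  | [], ls₁, rest => by
    simp only [List.append_nil, cbody_nil, List.nil_append, List.length_nil, Nat.mul_zero]
    exact SegRuns.nil (kr KR.btw) bpBody _
  | l :: ls₂, ls₁, rest => by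
    obtain ⟨ν, q⟩ := l
    have h1 := segRuns_bp_literal S L hB ν q (cbody ls₂ ++ rest) pt pf ft ff gt gf pos done ru cntf
      (∃ l ∈ ls₁, lookupB L l.1 = l.2)
    have hiff : ((∃ l ∈ ls₁, lookupB L l.1 = l.2) ∨ lookupB L ν = q) ↔
        ∃ l ∈ ls₁ ++ [(ν, q)], lookupB L l.1 = l.2 := by
      simp only [List.mem_append, List.mem_singleton, or_and_right, exists_or, exists_eq_left]
    rw [flagW_congr _ hiff] at h1
    have h2 := segRuns_bp_lits pt pf ft ff gt gf pos done ru cntf ls₂ (ls₁ ++ [(ν, q)]) rest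
    rw [List.append_assoc, List.singleton_append] at h2
    have := h1.append h2
    refine this.cast (by simp [cbody_cons, encodeLiteral_eq]) (by simp [cbody_cons, encodeLiteral_eq])
      rfl ?_
    simp only [cbody_cons, encodeLiteral_eq, List.length_append, List.length_cons, List.length_nil]
    simp only [List.length_cons, litBody]
    ring_nf; omega

end Literal2

/-- Some literal of the entry is true under the tuple held as the literal list `L`. [folklore] -/
def eTrue (L : List Lit) (e : Entry) : Bool := e.lits.any fun l => lookupB L l.1 == l.2

/-- The variable with table `es` is forced to `true` under the tuple `L`. [folklore] -/
def fT (L : List Lit) (es : List Entry) : Bool := es.any fun e => e.pt && !eTrue L e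

/-- The variable with table `es` is forced to `false` under the tuple `L`. [folklore] -/
def fF (L : List Lit) (es : List Entry) : Bool := es.any fun e => e.pf && !eTrue L e

/-- The variable with table `es` is forced under the tuple `L`. [folklore] -/
def fr (L : List Lit) (es : List Entry) : Bool := fT L es || fF L es

/-- `allFalse` is the negation of `eTrue`. [folklore] -/
theorem allFalse_eq (L : List Lit) (e : Entry) : e.allFalse (fun ν => lookupB L ν) = !eTrue L e := by
  unfold Entry.allFalse eTrue
  induction e.lits with
  | nil => rfl
  | cons l ls ih =>
    simp only [List.all_cons, List.any_cons, ih, Bool.not_or]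
    cases lookupB L l.1 <;> cases l.2 <;> rfl

/-- `fT` at the tuple `L` is `ftab` at the assignment `lookupB L`. [folklore] -/
theorem fT_eq_ftab (P : Params) (F : List (List (ℕ × Bool))) (L : List Lit) (z : ℕ) :
    fT L (entries P F z) = ftab P F z (fun ν => lookupB L ν) := by
  unfold fT ftab; congr 1; funext e; rw [allFalse_eq]

/-- `fF` at the tuple `L` is `ffab` at the assignment `lookupB L`. [folklore] -/
theorem fF_eq_ffab (P : Params) (F : List (List (ℕ × Bool))) (L : List Lit) (z : ℕ) :
    fF L (entries P F z) = ffab P F z (fun ν => lookupB L ν) := by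
  unfold fF ffab; congr 1; funext e; rw [allFalse_eq]

/-- `fr` at the tuple `L` is `forcedT` at the assignment `lookupB L`. [folklore] -/
theorem fr_eq_forcedT (P : Params) (F : List (List (ℕ × Bool))) (L : List Lit) (z : ℕ) :
    fr L (entries P F z) = forcedT P F z (fun ν => lookupB L ν) := by
  rw [fr, forcedT, fT_eq_ftab, fF_eq_ffab]

/-- The literal flag at the end of an entry is `eTrue`. [folklore] -/
theorem exists_lit_iff_eTrue (L : List Lit) (e : Entry) :
    (∃ l ∈ e.lits, lookupB L l.1 = l.2) ↔ eTrue L e = true := by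
  unfold eTrue; simp [List.any_eq_true]

section Entry

variable (S : RStore) (L : List Lit) (hB : BpBase S L)
include hB

omit hB in
/-- **`entryEnd`.** [folklore] -/
theorem runs_entryEnd (e : Entry) (btw gt gf pos done ru cntf : List Γ') (A B : Prop) [Decidable A]
    [Decidable B] :
    Runs entryEnd
      (bpSt S btw [] [Γ'.bit e.pt] [Γ'.bit e.pf] [] [] (flagW Γ'.blank (eTrue L e = true)) (flagW Γ'.blank A)
        (flagW Γ'.blank B) gt gf pos done ru cntf [])
      (bpSt S btw [] [] [] [] [] [] (flagW Γ'.blank (A ∨ (e.pt = true ∧ eTrue L e = false)))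
        (flagW Γ'.blank (B ∨ (e.pf = true ∧ eTrue L e = false))) gt gf pos done ru cntf [])
      16 := by
  unfold entryEnd
  have hA : (flagW Γ'.blank A).length ≤ 1 := length_flagW_le _ _
  have hBB : (flagW Γ'.blank B).length ≤ 1 := length_flagW_le _ _
  cases ht : eTrue L e with
  | true =>
    -- some literal true: the entry forces nothing
    rw [flagW_true _ rfl]
    have e1 : (A ∨ (e.pt = true ∧ true = false)) ↔ A := by simp
    have e2 : (B ∨ (e.pf = true ∧ true = false)) ↔ B := by simp
    rw [flagW_congr _ e1, flagW_congr _ e2]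
    have h1 : Runs (pop (kr KR.allf) (fun o => match o with
        | some _ => skip
        | none => (pop (kr KR.pt) fun o' => match o' with
            | some (Γ'.bit true) => setFlagG Γ'.blank (kr KR.ft)
            | _ => skip) ;;
          (pop (kr KR.pf) fun o' => match o' with
            | some (Γ'.bit true) => setFlagG Γ'.blank (kr KR.ff)
            | _ => skip)))
        (bpSt S btw [] [Γ'.bit e.pt] [Γ'.bit e.pf] [] [] [Γ'.blank] (flagW Γ'.blank A) (flagW Γ'.blank B)
          gt gf pos done ru cntf [])
        (bpSt S btw [] [Γ'.bit e.pt] [Γ'.bit e.pf] [] [] [] (flagW Γ'.blank A) (flagW Γ'.blank B)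
          gt gf pos done ru cntf []) (0 + 2) :=
      Runs.pop_cons (k := kr KR.allf) (a := Γ'.blank) (w := []) (by simp) ((Runs.skip _).of_eq (by simp) le_rfl)
    have h2 := runs_clear (kr KR.pt) (bpSt S btw [] [Γ'.bit e.pt] [Γ'.bit e.pf] [] [] [] (flagW Γ'.blank A)
      (flagW Γ'.blank B) gt gf pos done ru cntf [])
    rw [bpSt_pt, update_bpSt_pt] at h2
    have h3 := runs_clear (kr KR.pf) (bpSt S btw [] [] [Γ'.bit e.pf] [] [] [] (flagW Γ'.blank A)
      (flagW Γ'.blank B) gt gf pos done ru cntf [])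
    rw [bpSt_pf, update_bpSt_pf] at h3
    refine (h1.seq (h2.seq h3)).mono ?_
    simp
  | false =>
    rw [flagW_false _ (by simp)]
    -- the two pattern flags
    have hpt : Runs (pop (kr KR.pt) fun o' => match o' with
        | some (Γ'.bit true) => setFlagG Γ'.blank (kr KR.ft)
        | _ => skip)
        (bpSt S btw [] [Γ'.bit e.pt] [Γ'.bit e.pf] [] [] [] (flagW Γ'.blank A) (flagW Γ'.blank B)
          gt gf pos done ru cntf [])
        (bpSt S btw [] [] [Γ'.bit e.pf] [] [] [] (flagW Γ'.blank (A ∨ (e.pt = true ∧ false = false)))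
          (flagW Γ'.blank B) gt gf pos done ru cntf []) (4 + 2) := by
      refine Runs.pop_cons (k := kr KR.pt) (a := Γ'.bit e.pt) (w := []) (by simp) ?_
      rw [update_bpSt_pt]
      cases e.pt with
      | true =>
        have e1 : (A ∨ (true = true ∧ false = false)) := Or.inr ⟨rfl, rfl⟩
        rw [flagW_true _ e1]
        refine (runs_setFlagG Γ'.blank (kr KR.ft) _ (by simpa using hA)).of_eq ?_ le_rfl
        rw [update_bpSt_ft]
      | false =>
        have e1 : (A ∨ (false = true ∧ false = false)) ↔ A := by simp
        rw [flagW_congr _ e1]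
        exact (Runs.skip _).mono (by norm_num)
    have hA' : (flagW Γ'.blank (A ∨ (e.pt = true ∧ false = false))).length ≤ 1 := length_flagW_le _ _
    have hpf : Runs (pop (kr KR.pf) fun o' => match o' with
        | some (Γ'.bit true) => setFlagG Γ'.blank (kr KR.ff)
        | _ => skip)
        (bpSt S btw [] [] [Γ'.bit e.pf] [] [] [] (flagW Γ'.blank (A ∨ (e.pt = true ∧ false = false)))
          (flagW Γ'.blank B) gt gf pos done ru cntf [])
        (bpSt S btw [] [] [] [] [] [] (flagW Γ'.blank (A ∨ (e.pt = true ∧ false = false)))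
          (flagW Γ'.blank (B ∨ (e.pf = true ∧ false = false))) gt gf pos done ru cntf []) (4 + 2) := by
      refine Runs.pop_cons (k := kr KR.pf) (a := Γ'.bit e.pf) (w := []) (by simp) ?_
      rw [update_bpSt_pf]
      cases e.pf with
      | true =>
        have e1 : (B ∨ (true = true ∧ false = false)) := Or.inr ⟨rfl, rfl⟩
        rw [flagW_true _ e1]
        refine (runs_setFlagG Γ'.blank (kr KR.ff) _ (by simpa using hBB)).of_eq ?_ le_rfl
        rw [update_bpSt_ff]
      | false =>
        have e1 : (B ∨ (false = true ∧ false = false)) ↔ B := by simp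
        rw [flagW_congr _ e1]
        exact (Runs.skip _).mono (by norm_num)
    have h1 : Runs (pop (kr KR.allf) (fun o => match o with
        | some _ => skip
        | none => (pop (kr KR.pt) fun o' => match o' with
            | some (Γ'.bit true) => setFlagG Γ'.blank (kr KR.ft)
            | _ => skip) ;;
          (pop (kr KR.pf) fun o' => match o' with
            | some (Γ'.bit true) => setFlagG Γ'.blank (kr KR.ff)
            | _ => skip)))
        (bpSt S btw [] [Γ'.bit e.pt] [Γ'.bit e.pf] [] [] [] (flagW Γ'.blank A) (flagW Γ'.blank B)
          gt gf pos done ru cntf [])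
        (bpSt S btw [] [] [] [] [] [] (flagW Γ'.blank (A ∨ (e.pt = true ∧ false = false)))
          (flagW Γ'.blank (B ∨ (e.pf = true ∧ false = false))) gt gf pos done ru cntf [])
        (4 + 2 + (4 + 2) + 2) :=
      Runs.pop_nil (by simp) (hpt.seq hpf)
    have h2 := runs_clear (kr KR.pt) (bpSt S btw [] [] [] [] [] []
      (flagW Γ'.blank (A ∨ (e.pt = true ∧ false = false)))
      (flagW Γ'.blank (B ∨ (e.pf = true ∧ false = false))) gt gf pos done ru cntf [])
    rw [bpSt_pt, update_bpSt_pt] at h2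
    have h3 := runs_clear (kr KR.pf) (bpSt S btw [] [] [] [] [] []
      (flagW Γ'.blank (A ∨ (e.pt = true ∧ false = false)))
      (flagW Γ'.blank (B ∨ (e.pf = true ∧ false = false))) gt gf pos done ru cntf [])
    rw [bpSt_pf, update_bpSt_pf] at h3
    refine (h1.seq (h2.seq h3)).mono ?_
    simp

/-- **One entry of a variable's table** (mode empty before and after). [folklore] -/
theorem segRuns_bp_entry (e : Entry) (rest gt gf pos done ru cntf : List Γ') (A B : Prop) [Decidable A]
    [Decidable B] :
    SegRuns (kr KR.btw) bpBody (wEntry e)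
      (bpSt S (wEntry e ++ rest) [] [] [] [] [] [] (flagW Γ'.blank A) (flagW Γ'.blank B) gt gf pos done ru
        cntf [])
      (bpSt S rest [] [] [] [] [] [] (flagW Γ'.blank (A ∨ (e.pt = true ∧ eTrue L e = false)))
        (flagW Γ'.blank (B ∨ (e.pf = true ∧ eTrue L e = false))) gt gf pos done ru cntf [])
      (bpK L * (wEntry e).length) := by
  have hw : wEntry e = Γ'.bit e.pt :: Γ'.bit e.pf :: Γ'.comma :: (cbody e.lits ++ [Γ'.ket]) := rfl
  set fA := flagW Γ'.blank A with hfA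
  set fB := flagW Γ'.blank B with hfB
  -- the flag token
  have h1 : Runs (bpBody (Γ'.bit e.pt))
      (Function.update (bpSt S (wEntry e ++ rest) [] [] [] [] [] [] fA fB gt gf pos done ru cntf [])
        (kr KR.btw) (Γ'.bit e.pf :: Γ'.comma :: (cbody e.lits ++ [Γ'.ket]) ++ rest))
      (bpSt S (Γ'.bit e.pf :: Γ'.comma :: (cbody e.lits ++ [Γ'.ket]) ++ rest) [Γ'.bit false] [Γ'.bit e.pt]
        [] [] [] [] fA fB gt gf pos done ru cntf []) (2 + 2) := by
    rw [update_bpSt_btw]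
    unfold bpBody
    refine Runs.pop_nil (by simp) ?_
    exact ((Runs.push' (R' := bpSt S (Γ'.bit e.pf :: Γ'.comma :: (cbody e.lits ++ [Γ'.ket]) ++ rest) []
      [Γ'.bit e.pt] [] [] [] [] fA fB gt gf pos done ru cntf []) (by simp)).seq
      (Runs.push' (by simp))).of_eq rfl (by norm_num)
  have h2 : Runs (bpBody (Γ'.bit e.pf))
      (Function.update (bpSt S (Γ'.bit e.pf :: Γ'.comma :: (cbody e.lits ++ [Γ'.ket]) ++ rest) [Γ'.bit false]
        [Γ'.bit e.pt] [] [] [] [] fA fB gt gf pos done ru cntf [])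
        (kr KR.btw) (Γ'.comma :: (cbody e.lits ++ [Γ'.ket]) ++ rest))
      (bpSt S (Γ'.comma :: (cbody e.lits ++ [Γ'.ket]) ++ rest) [Γ'.bit true] [Γ'.bit e.pt] [Γ'.bit e.pf]
        [] [] [] fA fB gt gf pos done ru cntf []) (2 + 2) := by
    rw [update_bpSt_btw]
    unfold bpBody
    refine Runs.pop_cons (k := kr KR.md2) (a := Γ'.bit false) (w := []) (by simp) ?_
    rw [update_bpSt_md2]
    exact ((Runs.push' (R' := bpSt S (Γ'.comma :: (cbody e.lits ++ [Γ'.ket]) ++ rest) [] [Γ'.bit e.pt]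
      [Γ'.bit e.pf] [] [] [] fA fB gt gf pos done ru cntf []) (by simp)).seq
      (Runs.push' (by simp))).of_eq rfl (by norm_num)
  have h3 : Runs (bpBody Γ'.comma)
      (Function.update (bpSt S (Γ'.comma :: (cbody e.lits ++ [Γ'.ket]) ++ rest) [Γ'.bit true] [Γ'.bit e.pt]
        [Γ'.bit e.pf] [] [] [] fA fB gt gf pos done ru cntf [])
        (kr KR.btw) (cbody e.lits ++ [Γ'.ket] ++ rest))
      (bpSt S (cbody e.lits ++ [Γ'.ket] ++ rest) [Γ'.comma] [Γ'.bit e.pt] [Γ'.bit e.pf]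
        [] [] [] fA fB gt gf pos done ru cntf []) (1 + 2) := by
    rw [update_bpSt_btw]
    unfold bpBody
    refine Runs.pop_cons (k := kr KR.md2) (a := Γ'.bit true) (w := []) (by simp) ?_
    rw [update_bpSt_md2]
    exact Runs.push' (by simp)
  -- the literals
  have h4 := segRuns_bp_lits S L hB [Γ'.bit e.pt] [Γ'.bit e.pf] fA fB gt gf pos done ru cntf e.lits []
    ([Γ'.ket] ++ rest)
  have e0 : (∃ l ∈ ([] : List Lit), lookupB L l.1 = l.2) ↔ False := by simp
  rw [flagW_congr _ e0, List.nil_append, flagW_congr _ (exists_lit_iff_eTrue L e)] at h4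
  have hfalse : flagW Γ'.blank False = [] := flagW_false _ not_false
  rw [hfalse] at h4
  -- the ket
  have h5 : Runs (bpBody Γ'.ket)
      (Function.update (bpSt S ([Γ'.ket] ++ rest) [Γ'.comma] [Γ'.bit e.pt] [Γ'.bit e.pf] [] []
        (flagW Γ'.blank (eTrue L e = true)) fA fB gt gf pos done ru cntf []) (kr KR.btw) rest)
      (bpSt S rest [] [] [] [] [] [] (flagW Γ'.blank (A ∨ (e.pt = true ∧ eTrue L e = false)))
        (flagW Γ'.blank (B ∨ (e.pf = true ∧ eTrue L e = false))) gt gf pos done ru cntf []) (16 + 2) := by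
    rw [update_bpSt_btw]
    unfold bpBody
    refine Runs.pop_cons (k := kr KR.md2) (a := Γ'.comma) (w := []) (by simp) ?_
    rw [update_bpSt_md2, hfA, hfB]
    exact runs_entryEnd S L e rest gt gf pos done ru cntf A B
  -- chaining
  have hk1 : bpSt S (wEntry e ++ rest) [] [] [] [] [] [] fA fB gt gf pos done ru cntf [] (kr KR.btw) =
      Γ'.bit e.pt :: (Γ'.bit e.pf :: Γ'.comma :: (cbody e.lits ++ [Γ'.ket]) ++ rest) := by simp [hw]
  have hk2 : bpSt S (Γ'.bit e.pf :: Γ'.comma :: (cbody e.lits ++ [Γ'.ket]) ++ rest) [Γ'.bit false] [Γ'.bit e.pt]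
      [] [] [] [] fA fB gt gf pos done ru cntf [] (kr KR.btw) =
      Γ'.bit e.pf :: (Γ'.comma :: (cbody e.lits ++ [Γ'.ket]) ++ rest) := by simp
  have hk3 : bpSt S (Γ'.comma :: (cbody e.lits ++ [Γ'.ket]) ++ rest) [Γ'.bit true] [Γ'.bit e.pt] [Γ'.bit e.pf]
      [] [] [] fA fB gt gf pos done ru cntf [] (kr KR.btw) = Γ'.comma :: (cbody e.lits ++ [Γ'.ket] ++ rest) := by
    simp
  have hk5 : bpSt S ([Γ'.ket] ++ rest) [Γ'.comma] [Γ'.bit e.pt] [Γ'.bit e.pf] [] []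
      (flagW Γ'.blank (eTrue L e = true)) fA fB gt gf pos done ru cntf [] (kr KR.btw) = Γ'.ket :: rest := by simp
  have h45 := h4.append (SegRuns.single hk5 h5)
  have h345 := SegRuns.cons hk3 h3 (h45.cast rfl (by simp) rfl le_rfl)
  have h2345 := SegRuns.cons hk2 h2 h345
  have := SegRuns.cons hk1 h1 h2345
  refine this.cast (by simp [hw]) rfl rfl ?_
  simp only [hw, List.length_cons, List.length_append, bpK]
  nlinarith [Nat.zero_le ((cbody e.lits).length * (cbody L).length)]

/-- **The entries of a variable's table**: `ft`/`ff` accumulate `fT`/`fF`. [folklore] -/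
theorem segRuns_bp_entries (gt gf pos done ru cntf : List Γ') : ∀ (es₂ es₁ : List Entry) (rest : List Γ'),
    SegRuns (kr KR.btw) bpBody (es₂.flatMap wEntry)
      (bpSt S (es₂.flatMap wEntry ++ rest) [] [] [] [] [] [] (flagW Γ'.blank (fT L es₁ = true))
        (flagW Γ'.blank (fF L es₁ = true)) gt gf pos done ru cntf [])
      (bpSt S rest [] [] [] [] [] [] (flagW Γ'.blank (fT L (es₁ ++ es₂) = true))
        (flagW Γ'.blank (fF L (es₁ ++ es₂) = true)) gt gf pos done ru cntf [])
      (bpK L * (es₂.flatMap wEntry).length)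
  | [], es₁, rest => by
    simp only [List.append_nil, List.flatMap_nil, List.nil_append, List.length_nil, Nat.mul_zero]
    exact SegRuns.nil (kr KR.btw) bpBody _
  | e :: es₂, es₁, rest => by
    have h1 := segRuns_bp_entry S L hB e (es₂.flatMap wEntry ++ rest) gt gf pos done ru cntf
      (fT L es₁ = true) (fF L es₁ = true)
    have e1 : (fT L es₁ = true ∨ (e.pt = true ∧ eTrue L e = false)) ↔ fT L (es₁ ++ [e]) = true := by
      simp [fT, List.any_append]
    have e2 : (fF L es₁ = true ∨ (e.pf = true ∧ eTrue L e = false)) ↔ fF L (es₁ ++ [e]) = true := by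
      simp [fF, List.any_append]
    rw [flagW_congr _ e1, flagW_congr _ e2] at h1
    have h2 := segRuns_bp_entries gt gf pos done ru cntf es₂ (es₁ ++ [e]) rest
    rw [List.append_assoc, List.singleton_append] at h2
    have := h1.append h2
    refine this.cast (by simp) (by simp) rfl ?_
    simp only [List.flatMap_cons, List.length_append]
    ring_nf; omega

end Entry

section VarEnd

variable (S : RStore)

/-- **`cntStep`**: `cntf += forced`. [folklore] -/
theorem runs_cntStep (btw gt gf pos done ru cntf : List Γ') (T F : Prop) [Decidable T] [Decidable F] :
    Runs cntStep (bpSt S btw [] [] [] [] [] [] (flagW Γ'.blank T) (flagW Γ'.blank F) gt gf pos done ru cntf [])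
      (bpSt S btw [] [] [] [] [] [] (flagW Γ'.blank T) (flagW Γ'.blank F) gt gf pos done ru
        (if T ∨ F then Γ'.blank :: cntf else cntf) []) 6 := by
  unfold cntStep
  by_cases hT : T
  · rw [flagW_true _ hT, if_pos (Or.inl hT)]
    exact (Runs.ifTop_cons (x := Γ'.blank) (w := []) (by simp) (Runs.push' (by simp))).mono (by norm_num)
  · rw [flagW_false _ hT]
    refine (Runs.ifTop_nil (by simp) ?_).mono (show 4 + 2 ≤ 6 by norm_num)
    by_cases hF : F
    · rw [flagW_true _ hF, if_pos (Or.inr hF)]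
      exact Runs.ifTop_cons (x := Γ'.blank) (w := []) (by simp) (Runs.push' (by simp))
    · rw [flagW_false _ hF, if_neg (fun h => h.elim hT hF)]
      exact (Runs.ifTop_nil (by simp) (Runs.skip _)).mono (by norm_num)

/-- **`ruStep`**: `ru += unforced`. [folklore] -/
theorem runs_ruStep (btw gt gf pos done ru cntf : List Γ') (T F : Prop) [Decidable T] [Decidable F] :
    Runs ruStep (bpSt S btw [] [] [] [] [] [] (flagW Γ'.blank T) (flagW Γ'.blank F) gt gf pos done ru cntf [])
      (bpSt S btw [] [] [] [] [] [] (flagW Γ'.blank T) (flagW Γ'.blank F) gt gf pos done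
        (if T ∨ F then ru else Γ'.blank :: ru) cntf []) 6 := by
  unfold ruStep
  by_cases hT : T
  · rw [flagW_true _ hT, if_pos (Or.inl hT)]
    exact (Runs.ifTop_cons (x := Γ'.blank) (w := []) (by simp) (Runs.skip _)).mono (by norm_num)
  · rw [flagW_false _ hT]
    refine (Runs.ifTop_nil (by simp) ?_).mono (show 4 + 2 ≤ 6 by norm_num)
    by_cases hF : F
    · rw [flagW_true _ hF, if_pos (Or.inr hF)]
      exact (Runs.ifTop_cons (x := Γ'.blank) (w := []) (by simp) (Runs.skip _)).mono (by norm_num)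
    · rw [flagW_false _ hF, if_neg (fun h => h.elim hT hF)]
      exact (Runs.ifTop_nil (by simp) (Runs.push' (by simp))).mono (by norm_num)

/-- **`captureStep`**: copy the forcing flags of the target variable. [folklore] -/
theorem runs_captureStep (btw pos done ru cntf : List Γ') (T F : Prop) [Decidable T] [Decidable F] :
    Runs captureStep (bpSt S btw [] [] [] [] [] [] (flagW Γ'.blank T) (flagW Γ'.blank F) [] [] pos done ru cntf [])
      (bpSt S btw [] [] [] [] [] [] (flagW Γ'.blank T) (flagW Γ'.blank F) (flagW Γ'.blank T) (flagW Γ'.blank F)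
        pos done ru cntf []) 8 := by
  unfold captureStep
  have h1 : Runs (ifTop (kr KR.ft) fun o => match o with
      | some _ => push (kr KR.gt) Γ'.blank
      | none => skip)
      (bpSt S btw [] [] [] [] [] [] (flagW Γ'.blank T) (flagW Γ'.blank F) [] [] pos done ru cntf [])
      (bpSt S btw [] [] [] [] [] [] (flagW Γ'.blank T) (flagW Γ'.blank F) (flagW Γ'.blank T) [] pos done ru
        cntf []) 4 := by
    by_cases hT : T
    · rw [flagW_true _ hT]
      exact Runs.ifTop_cons (x := Γ'.blank) (w := []) (by simp) (Runs.push' (by simp))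
    · rw [flagW_false _ hT]
      exact (Runs.ifTop_nil (by simp) (Runs.skip _)).mono (by norm_num)
  have h2 : Runs (ifTop (kr KR.ff) fun o => match o with
      | some _ => push (kr KR.gf) Γ'.blank
      | none => skip)
      (bpSt S btw [] [] [] [] [] [] (flagW Γ'.blank T) (flagW Γ'.blank F) (flagW Γ'.blank T) [] pos done ru
        cntf [])
      (bpSt S btw [] [] [] [] [] [] (flagW Γ'.blank T) (flagW Γ'.blank F) (flagW Γ'.blank T) (flagW Γ'.blank F)
        pos done ru cntf []) 4 := by
    by_cases hF : F
    · rw [flagW_true _ hF]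
      exact Runs.ifTop_cons (x := Γ'.blank) (w := []) (by simp) (Runs.push' (by simp))
    · rw [flagW_false _ hF]
      exact (Runs.ifTop_nil (by simp) (Runs.skip _)).mono (by norm_num)
  exact h1.seq h2

end VarEnd

/-! ### The state of the block pass after a prefix of the variables of the block -/

section State

variable (L : List Lit)

/-- `cntf` after the variable tables `zss₁`: the number of forced variables, in unary.
[folklore] -/
def cntfW (zss₁ : List (List Entry)) : List Γ' := ticks Γ'.blank (zss₁.countP (fr L))

/-- `done` after `n` variables with target `j`. [folklore] -/
def doneW (n j : ℕ) : List Γ' := if j < n then [Γ'.blank] else []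

/-- `pos` after `n` variables with target `j`. [folklore] -/
def posW (n j : ℕ) : List Γ' := ticks Γ'.blank (j - n)

/-- `ru` after the variable tables `zss₁` with target `j`: the number of unforced variables before
the target, in unary. [folklore] -/
def ruW (zss₁ : List (List Entry)) (j : ℕ) : List Γ' :=
  ticks Γ'.blank ((zss₁.take j).countP fun es => !fr L es)

/-- `gt` after the variable tables `zss₁` with target `j`. [folklore] -/
def gtW (zss₁ : List (List Entry)) (j : ℕ) : List Γ' :=
  match zss₁[j]? with
  | some es => flagW Γ'.blank (fT L es = true)
  | none => []

/-- `gf` after the variable tables `zss₁` with target `j`. [folklore] -/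
def gfW (zss₁ : List (List Entry)) (j : ℕ) : List Γ' :=
  match zss₁[j]? with
  | some es => flagW Γ'.blank (fF L es = true)
  | none => []

/-- The store of the block pass at a variable boundary. [folklore] -/
def varSt (S : RStore) (btw : List Γ') (zss₁ : List (List Entry)) (j : ℕ) (ft ff : List Γ') : RStore :=
  bpSt S btw [] [] [] [] [] [] ft ff (gtW L zss₁ j) (gfW L zss₁ j) (posW zss₁.length j)
    (doneW zss₁.length j) (ruW L zss₁ j) (cntfW L zss₁) []

end State

section Var

variable (S : RStore) (L : List Lit) (hB : BpBase S L)
include hB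

omit hB in
/-- **`varEnd`**: the state advances by the variable with table `es`. [folklore] -/
theorem runs_varEnd (es : List Entry) (zss₁ : List (List Entry)) (j : ℕ) (btw : List Γ') :
    Runs varEnd (varSt L S btw zss₁ j (flagW Γ'.blank (fT L es = true)) (flagW Γ'.blank (fF L es = true)))
      (varSt L S btw (zss₁ ++ [es]) j [] []) 25 := by
  unfold varEnd varSt
  set n := zss₁.length with hn
  have hfr : (fT L es = true ∨ fF L es = true) ↔ fr L es = true := by simp [fr]
  -- the new state components
  have hcnt : (if fT L es = true ∨ fF L es = true then Γ'.blank :: cntfW L zss₁ else cntfW L zss₁) =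
      cntfW L (zss₁ ++ [es]) := by
    unfold cntfW
    rw [List.countP_append]
    by_cases h : fr L es = true
    · rw [if_pos (hfr.2 h)]
      have : [es].countP (fr L) = 1 := by simp [h]
      rw [this, ticks_succ]
    · rw [if_neg (fun h' => h (hfr.1 h'))]
      have : [es].countP (fr L) = 0 := by simp [h]
      rw [this, Nat.add_zero]
  have hlen : (zss₁ ++ [es]).length = n + 1 := by simp [hn]
  rcases lt_trichotomy j n with hj | hj | hj
  · -- past the target: `done` is up
    have hdone : doneW n j = [Γ'.blank] := if_pos hj
    have hdone' : doneW (n + 1) j = [Γ'.blank] := if_pos (by omega)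
    have hpos : posW n j = posW (n + 1) j := by simp [posW, Nat.sub_eq_zero_of_le hj.le, Nat.sub_eq_zero_of_le (by omega : j ≤ n + 1)]
    have hru : ruW L zss₁ j = ruW L (zss₁ ++ [es]) j := by
      unfold ruW; rw [List.take_append_of_le_length hj.le]
    have hgt : gtW L zss₁ j = gtW L (zss₁ ++ [es]) j := by
      unfold gtW; rw [List.getElem?_append_left (by omega)]
    have hgf : gfW L zss₁ j = gfW L (zss₁ ++ [es]) j := by
      unfold gfW; rw [List.getElem?_append_left (by omega)]
    rw [hlen, hdone, hdone', ← hpos, ← hru, ← hgt, ← hgf]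
    have h1 : Runs (pop (kr KR.done) (fun o => match o with
        | some d => push (kr KR.done) d ;; cntStep
        | none => pop (kr KR.pos) fun o' => match o' with
            | some _ => cntStep ;; ruStep
            | none => captureStep ;; push (kr KR.done) Γ'.blank ;; cntStep))
        (bpSt S btw [] [] [] [] [] [] (flagW Γ'.blank (fT L es = true)) (flagW Γ'.blank (fF L es = true))
          (gtW L zss₁ j) (gfW L zss₁ j) (posW n j) [Γ'.blank] (ruW L zss₁ j) (cntfW L zss₁) [])
        (bpSt S btw [] [] [] [] [] [] (flagW Γ'.blank (fT L es = true)) (flagW Γ'.blank (fF L es = true))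
          (gtW L zss₁ j) (gfW L zss₁ j) (posW n j) [Γ'.blank] (ruW L zss₁ j) (cntfW L (zss₁ ++ [es])) [])
        (1 + 6 + 2) := by
      refine Runs.pop_cons (k := kr KR.done) (a := Γ'.blank) (w := []) (by simp) ?_
      rw [update_bpSt_done]
      refine (Runs.push' (R' := bpSt S btw [] [] [] [] [] [] (flagW Γ'.blank (fT L es = true))
        (flagW Γ'.blank (fF L es = true)) (gtW L zss₁ j) (gfW L zss₁ j) (posW n j) [Γ'.blank] (ruW L zss₁ j)
        (cntfW L zss₁) []) (by simp)).seq ?_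
      rw [← hcnt]
      exact runs_cntStep S btw _ _ _ _ _ _ (fT L es = true) (fF L es = true)
    have h2 := runs_clear (kr KR.ft) (bpSt S btw [] [] [] [] [] [] (flagW Γ'.blank (fT L es = true))
      (flagW Γ'.blank (fF L es = true)) (gtW L zss₁ j) (gfW L zss₁ j) (posW n j) [Γ'.blank] (ruW L zss₁ j)
      (cntfW L (zss₁ ++ [es])) [])
    rw [bpSt_ft, update_bpSt_ft] at h2
    have h3 := runs_clear (kr KR.ff) (bpSt S btw [] [] [] [] [] [] []
      (flagW Γ'.blank (fF L es = true)) (gtW L zss₁ j) (gfW L zss₁ j) (posW n j) [Γ'.blank] (ruW L zss₁ j)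
      (cntfW L (zss₁ ++ [es])) [])
    rw [bpSt_ff, update_bpSt_ff] at h3
    have hl1 : (flagW Γ'.blank (fT L es = true)).length ≤ 1 := length_flagW_le _ _
    have hl2 : (flagW Γ'.blank (fF L es = true)).length ≤ 1 := length_flagW_le _ _
    exact (h1.seq (h2.seq h3)).mono (by omega)
  · -- the target variable
    subst hj
    have hdone : doneW n n = [] := if_neg (lt_irrefl _)
    have hdone' : doneW (n + 1) n = [Γ'.blank] := if_pos (by omega)
    have hpos : posW n n = [] := by rw [posW, Nat.sub_self, ticks_zero]
    have hpos' : posW (n + 1) n = [] := by rw [posW, Nat.sub_eq_zero_of_le (Nat.le_succ n), ticks_zero]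
    have hru : ruW L zss₁ n = ruW L (zss₁ ++ [es]) n := by
      unfold ruW; rw [List.take_append_of_le_length le_rfl]
    have hgt : gtW L zss₁ n = [] := by unfold gtW; rw [List.getElem?_eq_none (by omega)]
    have hgf : gfW L zss₁ n = [] := by unfold gfW; rw [List.getElem?_eq_none (by omega)]
    have hgt' : gtW L (zss₁ ++ [es]) n = flagW Γ'.blank (fT L es = true) := by
      unfold gtW; rw [List.getElem?_append_right (by omega), hn, Nat.sub_self]; rfl
    have hgf' : gfW L (zss₁ ++ [es]) n = flagW Γ'.blank (fF L es = true) := by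
      unfold gfW; rw [List.getElem?_append_right (by omega), hn, Nat.sub_self]; rfl
    rw [hlen, hdone, hdone', hpos, hpos', ← hru, hgt, hgf, hgt', hgf']
    have h1 : Runs (pop (kr KR.done) (fun o => match o with
        | some d => push (kr KR.done) d ;; cntStep
        | none => pop (kr KR.pos) fun o' => match o' with
            | some _ => cntStep ;; ruStep
            | none => captureStep ;; push (kr KR.done) Γ'.blank ;; cntStep))
        (bpSt S btw [] [] [] [] [] [] (flagW Γ'.blank (fT L es = true)) (flagW Γ'.blank (fF L es = true))
          [] [] [] [] (ruW L zss₁ n) (cntfW L zss₁) [])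
        (bpSt S btw [] [] [] [] [] [] (flagW Γ'.blank (fT L es = true)) (flagW Γ'.blank (fF L es = true))
          (flagW Γ'.blank (fT L es = true)) (flagW Γ'.blank (fF L es = true)) [] [Γ'.blank] (ruW L zss₁ n)
          (cntfW L (zss₁ ++ [es])) [])
        (8 + (1 + 6) + 2 + 2) := by
      refine Runs.pop_nil (by simp) ?_
      refine Runs.pop_nil (by simp) ?_
      refine (runs_captureStep S btw [] [] (ruW L zss₁ n) (cntfW L zss₁) (fT L es = true) (fF L es = true)).seq ?_
      have hp : Runs (push (kr KR.done) Γ'.blank)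
          (bpSt S btw [] [] [] [] [] [] (flagW Γ'.blank (fT L es = true)) (flagW Γ'.blank (fF L es = true))
            (flagW Γ'.blank (fT L es = true)) (flagW Γ'.blank (fF L es = true)) [] [] (ruW L zss₁ n)
            (cntfW L zss₁) [])
          (bpSt S btw [] [] [] [] [] [] (flagW Γ'.blank (fT L es = true)) (flagW Γ'.blank (fF L es = true))
            (flagW Γ'.blank (fT L es = true)) (flagW Γ'.blank (fF L es = true)) [] [Γ'.blank] (ruW L zss₁ n)
            (cntfW L zss₁) []) 1 := Runs.push' (by rw [update_bpSt_done, bpSt_done])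
      rw [← hcnt]
      exact (hp.seq (runs_cntStep S btw _ _ _ _ _ _ (fT L es = true) (fF L es = true))).of_eq rfl
        (by norm_num)
    have h2 := runs_clear (kr KR.ft) (bpSt S btw [] [] [] [] [] [] (flagW Γ'.blank (fT L es = true))
      (flagW Γ'.blank (fF L es = true)) (flagW Γ'.blank (fT L es = true)) (flagW Γ'.blank (fF L es = true))
      [] [Γ'.blank] (ruW L zss₁ n) (cntfW L (zss₁ ++ [es])) [])
    rw [bpSt_ft, update_bpSt_ft] at h2
    have h3 := runs_clear (kr KR.ff) (bpSt S btw [] [] [] [] [] [] []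
      (flagW Γ'.blank (fF L es = true)) (flagW Γ'.blank (fT L es = true)) (flagW Γ'.blank (fF L es = true))
      [] [Γ'.blank] (ruW L zss₁ n) (cntfW L (zss₁ ++ [es])) [])
    rw [bpSt_ff, update_bpSt_ff] at h3
    have hl1 : (flagW Γ'.blank (fT L es = true)).length ≤ 1 := length_flagW_le _ _
    have hl2 : (flagW Γ'.blank (fF L es = true)).length ≤ 1 := length_flagW_le _ _
    exact (h1.seq (h2.seq h3)).mono (by omega)
  · -- before the target: `pos` is nonempty
    have hdone : doneW n j = [] := if_neg (by omega)
    have hdone' : doneW (n + 1) j = [] := if_neg (by omega)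
    have hpos : posW n j = Γ'.blank :: posW (n + 1) j := by
      simp only [posW, ticks]
      rw [show j - n = (j - (n + 1)) + 1 by omega, List.replicate_succ]
    have hru : (if fT L es = true ∨ fF L es = true then ruW L zss₁ j else Γ'.blank :: ruW L zss₁ j) =
        ruW L (zss₁ ++ [es]) j := by
      unfold ruW
      rw [List.take_of_length_le (by omega), List.take_of_length_le (by simp; omega), List.countP_append]
      by_cases h : fr L es = true
      · rw [if_pos (hfr.2 h)]
        have : [es].countP (fun es => !fr L es) = 0 := by simp [h]
        rw [this, Nat.add_zero]
      · rw [if_neg (fun h' => h (hfr.1 h'))]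
        have : [es].countP (fun es => !fr L es) = 1 := by simp [h]
        rw [this, ticks_succ]
    have hgt : gtW L zss₁ j = [] := by unfold gtW; rw [List.getElem?_eq_none (by omega)]
    have hgf : gfW L zss₁ j = [] := by unfold gfW; rw [List.getElem?_eq_none (by omega)]
    have hgt' : gtW L (zss₁ ++ [es]) j = [] := by unfold gtW; rw [List.getElem?_eq_none (by simp; omega)]
    have hgf' : gfW L (zss₁ ++ [es]) j = [] := by unfold gfW; rw [List.getElem?_eq_none (by simp; omega)]
    rw [hlen, hdone, hdone', hpos, hgt, hgf, hgt', hgf', ← hru]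
    have h1 : Runs (pop (kr KR.done) (fun o => match o with
        | some d => push (kr KR.done) d ;; cntStep
        | none => pop (kr KR.pos) fun o' => match o' with
            | some _ => cntStep ;; ruStep
            | none => captureStep ;; push (kr KR.done) Γ'.blank ;; cntStep))
        (bpSt S btw [] [] [] [] [] [] (flagW Γ'.blank (fT L es = true)) (flagW Γ'.blank (fF L es = true))
          [] [] (Γ'.blank :: posW (n + 1) j) [] (ruW L zss₁ j) (cntfW L zss₁) [])
        (bpSt S btw [] [] [] [] [] [] (flagW Γ'.blank (fT L es = true)) (flagW Γ'.blank (fF L es = true))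
          [] [] (posW (n + 1) j) []
          (if fT L es = true ∨ fF L es = true then ruW L zss₁ j else Γ'.blank :: ruW L zss₁ j)
          (cntfW L (zss₁ ++ [es])) [])
        (6 + 6 + 2 + 2) := by
      refine Runs.pop_nil (by simp) ?_
      refine Runs.pop_cons (k := kr KR.pos) (a := Γ'.blank) (w := posW (n + 1) j) (by simp) ?_
      rw [update_bpSt_pos, ← hcnt]
      exact (runs_cntStep S btw _ _ _ _ _ _ (fT L es = true) (fF L es = true)).seq
        (runs_ruStep S btw _ _ _ _ _ _ (fT L es = true) (fF L es = true))
    have h2 := runs_clear (kr KR.ft) (bpSt S btw [] [] [] [] [] [] (flagW Γ'.blank (fT L es = true))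
      (flagW Γ'.blank (fF L es = true)) [] [] (posW (n + 1) j) []
      (if fT L es = true ∨ fF L es = true then ruW L zss₁ j else Γ'.blank :: ruW L zss₁ j)
      (cntfW L (zss₁ ++ [es])) [])
    rw [bpSt_ft, update_bpSt_ft] at h2
    have h3 := runs_clear (kr KR.ff) (bpSt S btw [] [] [] [] [] [] []
      (flagW Γ'.blank (fF L es = true)) [] [] (posW (n + 1) j) []
      (if fT L es = true ∨ fF L es = true then ruW L zss₁ j else Γ'.blank :: ruW L zss₁ j)
      (cntfW L (zss₁ ++ [es])) [])
    rw [bpSt_ff, update_bpSt_ff] at h3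
    have hl1 : (flagW Γ'.blank (fT L es = true)).length ≤ 1 := length_flagW_le _ _
    have hl2 : (flagW Γ'.blank (fF L es = true)).length ≤ 1 := length_flagW_le _ _
    exact (h1.seq (h2.seq h3)).mono (by omega)

end Var

/-- `fT` of the empty table. [folklore] -/
@[simp] theorem fT_nil (L : List Lit) : fT L [] = false := rfl
/-- `fF` of the empty table. [folklore] -/
@[simp] theorem fF_nil (L : List Lit) : fF L [] = false := rfl

/-- The blank occurs in no entry word. [folklore] -/
theorem blank_not_mem_wEntry (e : Entry) : Γ'.blank ∉ wEntry e := by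
  unfold wEntry
  simp only [List.mem_cons, List.mem_append, not_or]
  refine ⟨by simp, by simp, by simp, ?_, by simp⟩
  intro h
  unfold cbody at h
  simp only [List.mem_flatMap] at h
  obtain ⟨l, -, hl⟩ := h
  simp [KCNF.encodeLiteral] at hl

/-- The blank occurs in no variable word. [folklore] -/
theorem blank_not_mem_wVar (es : List Entry) : Γ'.blank ∉ wVar es := by
  unfold wVar
  simp only [List.mem_append, List.mem_flatMap, List.mem_singleton, not_or]
  exact ⟨fun ⟨e, _, he⟩ => blank_not_mem_wEntry e he, by simp⟩

/-- The blank occurs in the word of a block only at its end. [folklore] -/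
theorem blank_not_mem_flatMap_wVar (zss : List (List Entry)) : Γ'.blank ∉ zss.flatMap wVar := by
  simp only [List.mem_flatMap, not_exists, not_and]
  exact fun es _ => blank_not_mem_wVar es

section Blocks

variable (S : RStore) (L : List Lit) (hB : BpBase S L)
include hB

/-- **One variable of the block** (its table, then `bra`). [folklore] -/
theorem segRuns_bp_var (es : List Entry) (zss₁ : List (List Entry)) (j : ℕ) (rest : List Γ') :
    SegRuns (kr KR.btw) bpBody (wVar es) (varSt L S (wVar es ++ rest) zss₁ j [] [])
      (varSt L S rest (zss₁ ++ [es]) j [] []) (bpK L * (wVar es).length) := by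
  have hw : wVar es = es.flatMap wEntry ++ [Γ'.bra] := rfl
  have h1 := segRuns_bp_entries S L hB (gtW L zss₁ j) (gfW L zss₁ j) (posW zss₁.length j)
    (doneW zss₁.length j) (ruW L zss₁ j) (cntfW L zss₁) es [] ([Γ'.bra] ++ rest)
  have e1 : flagW Γ'.blank (fT L [] = true) = [] := flagW_false _ (by simp)
  have e2 : flagW Γ'.blank (fF L [] = true) = [] := flagW_false _ (by simp)
  rw [e1, e2, List.nil_append] at h1
  have h2 : Runs (bpBody Γ'.bra)
      (Function.update (varSt L S ([Γ'.bra] ++ rest) zss₁ j (flagW Γ'.blank (fT L es = true))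
        (flagW Γ'.blank (fF L es = true))) (kr KR.btw) rest)
      (varSt L S rest (zss₁ ++ [es]) j [] []) (25 + 2) := by
    unfold varSt
    rw [update_bpSt_btw]
    unfold bpBody
    refine Runs.pop_nil (by simp) ?_
    exact runs_varEnd S L es zss₁ j rest
  have hk2 : varSt L S ([Γ'.bra] ++ rest) zss₁ j (flagW Γ'.blank (fT L es = true))
      (flagW Γ'.blank (fF L es = true)) (kr KR.btw) = Γ'.bra :: rest := by simp [varSt]
  have := h1.append (SegRuns.single hk2 h2)
  rw [hw]
  refine this.cast rfl (by simp [varSt]) rfl ?_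
  simp only [List.length_append, List.length_singleton, bpK]
  nlinarith

/-- **A run of variables of the block.** [folklore] -/
theorem segRuns_bp_vars (j : ℕ) : ∀ (zss₂ zss₁ : List (List Entry)) (rest : List Γ'),
    SegRuns (kr KR.btw) bpBody (zss₂.flatMap wVar) (varSt L S (zss₂.flatMap wVar ++ rest) zss₁ j [] [])
      (varSt L S rest (zss₁ ++ zss₂) j [] []) (bpK L * (zss₂.flatMap wVar).length)
  | [], zss₁, rest => by
    simp only [List.flatMap_nil, List.nil_append, List.append_nil, List.length_nil, Nat.mul_zero]
    exact SegRuns.nil (kr KR.btw) bpBody _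
  | es :: zss₂, zss₁, rest => by
    have h1 := segRuns_bp_var S L hB es zss₁ j (zss₂.flatMap wVar ++ rest)
    have h2 := segRuns_bp_vars j zss₂ (zss₁ ++ [es]) rest
    rw [List.append_assoc, List.singleton_append] at h2
    have := h1.append h2
    refine this.cast (by simp) (by simp) rfl ?_
    simp only [List.flatMap_cons, List.length_append]; ring_nf; omega

omit hB in
/-- **Past the block**: every further symbol is ignored (mode `blank`). [folklore] -/
theorem segRuns_bp_ignore (pt pf lpol pr allf ft ff gt gf pos done ru cntf : List Γ') :
    ∀ (u rest : List Γ'),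
      SegRuns (kr KR.btw) bpBody u
        (bpSt S (u ++ rest) [Γ'.blank] pt pf lpol pr allf ft ff gt gf pos done ru cntf [])
        (bpSt S rest [Γ'.blank] pt pf lpol pr allf ft ff gt gf pos done ru cntf []) (5 * u.length)
  | [], rest => by simpa using SegRuns.nil (kr KR.btw) bpBody _
  | s :: u, rest => by
    have hbody : Runs (bpBody s)
        (Function.update (bpSt S (s :: u ++ rest) [Γ'.blank] pt pf lpol pr allf ft ff gt gf pos done ru cntf [])
          (kr KR.btw) (u ++ rest))
        (bpSt S (u ++ rest) [Γ'.blank] pt pf lpol pr allf ft ff gt gf pos done ru cntf []) (1 + 2) := by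
      rw [update_bpSt_btw]
      unfold bpBody
      refine Runs.pop_cons (k := kr KR.md2) (a := Γ'.blank) (w := []) (by simp) ?_
      rw [update_bpSt_md2]
      cases s <;> exact Runs.push' (by simp)
    have ih := segRuns_bp_ignore pt pf lpol pr allf ft ff gt gf pos done ru cntf u rest
    have hk : bpSt S (s :: u ++ rest) [Γ'.blank] pt pf lpol pr allf ft ff gt gf pos done ru cntf [] (kr KR.btw) =
        s :: (u ++ rest) := by simp
    refine (SegRuns.cons hk hbody ih).cast rfl rfl rfl ?_
    simp only [List.length_cons]; omega

omit hB in
/-- **Skipping**: inside a block before the wanted one (mode `bra`), non-blank symbols are passed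
over. [folklore] -/
theorem segRuns_bp_skip_inner (pos : List Γ') :
    ∀ (u : List Γ'), Γ'.blank ∉ u → ∀ rest : List Γ',
      SegRuns (kr KR.btw) bpBody u
        (bpSt S (u ++ rest) [Γ'.bra] [] [] [] [] [] [] [] [] [] pos [] [] [] [])
        (bpSt S rest [Γ'.bra] [] [] [] [] [] [] [] [] [] pos [] [] [] []) (5 * u.length)
  | [], _, rest => by simpa using SegRuns.nil (kr KR.btw) bpBody _
  | s :: u, hu, rest => by
    have hs : s ≠ Γ'.blank := fun h => hu (by simp [h])
    have hu' : Γ'.blank ∉ u := fun h => hu (by simp [h])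
    have hbody : Runs (bpBody s)
        (Function.update (bpSt S (s :: u ++ rest) [Γ'.bra] [] [] [] [] [] [] [] [] [] pos [] [] [] [])
          (kr KR.btw) (u ++ rest))
        (bpSt S (u ++ rest) [Γ'.bra] [] [] [] [] [] [] [] [] [] pos [] [] [] []) (1 + 2) := by
      rw [update_bpSt_btw]
      unfold bpBody
      refine Runs.pop_cons (k := kr KR.md2) (a := Γ'.bra) (w := []) (by simp) ?_
      rw [update_bpSt_md2]
      cases s with
      | blank => exact absurd rfl hs
      | bit b => exact Runs.push' (by simp)
      | bra => exact Runs.push' (by simp)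
      | ket => exact Runs.push' (by simp)
      | comma => exact Runs.push' (by simp)
    have ih := segRuns_bp_skip_inner pos u hu' rest
    have hk : bpSt S (s :: u ++ rest) [Γ'.bra] [] [] [] [] [] [] [] [] [] pos [] [] [] [] (kr KR.btw) =
        s :: (u ++ rest) := by simp
    refine (SegRuns.cons hk hbody ih).cast rfl rfl rfl ?_
    simp only [List.length_cons]; omega

omit hB in
/-- **Skipping one block** before the wanted one: at its closing blank the skip counter `blk` is
decremented, and the mode leaves `bra` when it reaches zero. [folklore] -/
theorem segRuns_bp_skip_block (pos : List Γ') (zss : List (List Entry)) (u rest : List Γ') :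
    SegRuns (kr KR.btw) bpBody (wBlock zss)
      (bpSt (Function.update S (kr KR.blk) (Γ'.blank :: u)) (wBlock zss ++ rest) [Γ'.bra]
        [] [] [] [] [] [] [] [] [] pos [] [] [] [])
      (bpSt (Function.update S (kr KR.blk) u) rest (if u = [] then [] else [Γ'.bra])
        [] [] [] [] [] [] [] [] [] pos [] [] [] [])
      (bpK L * (wBlock zss).length) := by
  have hw : wBlock zss = zss.flatMap wVar ++ [Γ'.blank] := rfl
  have h1 := segRuns_bp_skip_inner (Function.update S (kr KR.blk) (Γ'.blank :: u)) pos (zss.flatMap wVar)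
    (blank_not_mem_flatMap_wVar zss) ([Γ'.blank] ++ rest)
  have h2 : Runs (bpBody Γ'.blank)
      (Function.update (bpSt (Function.update S (kr KR.blk) (Γ'.blank :: u)) ([Γ'.blank] ++ rest) [Γ'.bra]
        [] [] [] [] [] [] [] [] [] pos [] [] [] []) (kr KR.btw) rest)
      (bpSt (Function.update S (kr KR.blk) u) rest (if u = [] then [] else [Γ'.bra])
        [] [] [] [] [] [] [] [] [] pos [] [] [] []) (4 + 2 + 2) := by
    rw [update_bpSt_btw]
    unfold bpBody
    refine Runs.pop_cons (k := kr KR.md2) (a := Γ'.bra) (w := []) (by simp) ?_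
    rw [update_bpSt_md2]
    refine Runs.pop_cons (k := kr KR.blk) (a := Γ'.blank) (w := u) (by simp) ?_
    rw [update_bpSt_of_other _ _ _ _ _ _ _ _ _ _ _ _ _ _ _ _ _ (by simp) (by simp) (by simp) (by simp)
      (by simp) (by simp) (by simp) (by simp) (by simp) (by simp) (by simp) (by simp) (by simp) (by simp)
      (by simp) (by simp), Function.update_idem]
    cases u with
    | nil =>
      rw [if_pos rfl]
      exact (Runs.ifTop_nil (by simp) (Runs.skip _)).mono (by norm_num)
    | cons t u =>
      rw [if_neg (List.cons_ne_nil _ _)]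
      exact Runs.ifTop_cons (x := t) (w := u) (by simp) (Runs.push' (by simp))
  have hk2 : bpSt (Function.update S (kr KR.blk) (Γ'.blank :: u)) ([Γ'.blank] ++ rest) [Γ'.bra]
      [] [] [] [] [] [] [] [] [] pos [] [] [] [] (kr KR.btw) = Γ'.blank :: rest := by simp
  have := h1.append (SegRuns.single hk2 h2)
  rw [hw]
  refine this.cast rfl (by simp) rfl ?_
  simp only [List.length_append, List.length_singleton, bpK]
  nlinarith

omit hB in
/-- **Skipping the blocks before the wanted one.** [folklore] -/
theorem segRuns_bp_skip (pos : List Γ') : ∀ (zsss : List (List (List Entry))) (u rest : List Γ'),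
    zsss ≠ [] →
    SegRuns (kr KR.btw) bpBody (zsss.flatMap wBlock)
      (bpSt (Function.update S (kr KR.blk) (ticks Γ'.blank zsss.length ++ u)) (zsss.flatMap wBlock ++ rest)
        [Γ'.bra] [] [] [] [] [] [] [] [] [] pos [] [] [] [])
      (bpSt (Function.update S (kr KR.blk) u) rest (if u = [] then [] else [Γ'.bra])
        [] [] [] [] [] [] [] [] [] pos [] [] [] [])
      (bpK L * (zsss.flatMap wBlock).length)
  | [], _, _, h => absurd rfl h
  | [zss], u, rest, _ => by
    have := segRuns_bp_skip_block S L pos zss u rest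
    refine this.cast (by simp) (by simp [ticks]) rfl (by simp)
  | zss :: zss' :: zsss, u, rest, _ => by
    have h1 := segRuns_bp_skip_block S L pos zss (ticks Γ'.blank (zss' :: zsss).length ++ u)
      ((zss' :: zsss).flatMap wBlock ++ rest)
    have hne : ticks Γ'.blank (zss' :: zsss).length ++ u ≠ [] := by simp [ticks]
    rw [if_neg hne] at h1
    have h2 := segRuns_bp_skip pos (zss' :: zsss) u rest (List.cons_ne_nil _ _)
    have := h1.append h2
    refine this.cast (by simp) ?_ rfl ?_
    · simp [ticks, List.replicate_succ]
    · simp only [List.flatMap_cons, List.length_append]; ring_nf; omega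

end Blocks

/-- The base hypotheses do not mention `blk`. [folklore] -/
theorem BpBase.update_blk {S : RStore} {L : List Lit} (h : BpBase S L) (u : List Γ') :
    BpBase (Function.update S (kr KR.blk) u) L :=
  ⟨by simp [h.vt], by simp [h.vw], by simp [h.fnd], by simp [h.ex], by simp [h.eb], by simp [h.lmd],
    by simp [h.ne], by simp [h.x2], by simp [h.t1], by simp [h.t2]⟩

/-- **Specification of the block pass.** On the block table `zsss` (as its word in `btw`), with
`blk = i` ticks, `pos = j` ticks (`i`-th block, `j`-th variable of it) and everything else of the
pass empty: afterwards `cntf` counts the forced variables of block `i`, `ru` the unforced ones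
before position `j`, `gt`/`gf` are the forcing flags of the `j`-th variable, `done` is up, and
`btw`, `blk`, `pos` are empty; within `bpK L · |wBT zsss| + 8` steps. [folklore] -/
theorem runs_blockPass (S : RStore) (L : List Lit) (hB : BpBase S L) (zsss : List (List (List Entry)))
    (i j : ℕ) (hi : i < zsss.length) (hj : j < (zsss[i]).length) (hblk : S (kr KR.blk) = ticks Γ'.blank i) :
    Runs blockPass (bpSt S (wBT zsss) [] [] [] [] [] [] [] [] [] [] (ticks Γ'.blank j) [] [] [] [])
      (bpSt (Function.update S (kr KR.blk) []) [] [] [] [] [] [] [] [] [] (gtW L zsss[i] j) (gfW L zsss[i] j)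
        [] [Γ'.blank] (ruW L zsss[i] j) (cntfW L zsss[i]) [])
      (bpK L * (wBT zsss).length + 8) := by
  set zs := zsss[i] with hzs
  set S' := Function.update S (kr KR.blk) [] with hS'
  have hB' : BpBase S' L := hB.update_blk []
  have hsplit : zsss = zsss.take i ++ zs :: zsss.drop (i + 1) := by
    rw [hzs, ← List.drop_eq_getElem_cons hi, List.take_append_drop]
  have hwBT : wBT zsss = (zsss.take i).flatMap wBlock ++ (zs.flatMap wVar ++ ([Γ'.blank] ++
      (zsss.drop (i + 1)).flatMap wBlock)) := by
    conv_lhs => rw [hsplit]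
    simp [wBT, wBlock]
  set tail := (zsss.drop (i + 1)).flatMap wBlock with htail
  -- prelude and skipping: reach the wanted block in mode "variable start" with `blk` empty
  have hpre : Runs ((ifTop (kr KR.blk) fun o => match o with
        | some _ => push (kr KR.md2) Γ'.bra
        | none => skip))
      (bpSt S (wBT zsss) [] [] [] [] [] [] [] [] [] [] (ticks Γ'.blank j) [] [] [] [])
      (bpSt S (wBT zsss) (if i = 0 then [] else [Γ'.bra]) [] [] [] [] [] [] [] [] [] (ticks Γ'.blank j)
        [] [] [] []) 4 := by
    cases i with
    | zero =>
      rw [if_pos rfl]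
      exact (Runs.ifTop_nil (by simp [hblk, ticks]) (Runs.skip _)).mono (by norm_num)
    | succ i =>
      rw [if_neg (Nat.succ_ne_zero i)]
      exact Runs.ifTop_cons (x := Γ'.blank) (w := ticks Γ'.blank i) (by simp [hblk, ticks_succ])
        (Runs.push' (by simp))
  have hskip : SegRuns (kr KR.btw) bpBody ((zsss.take i).flatMap wBlock)
      (bpSt S (wBT zsss) (if i = 0 then [] else [Γ'.bra]) [] [] [] [] [] [] [] [] [] (ticks Γ'.blank j)
        [] [] [] [])
      (varSt L S' (zs.flatMap wVar ++ ([Γ'.blank] ++ tail)) [] j [] [])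
      (bpK L * ((zsss.take i).flatMap wBlock).length) := by
    have hvar : varSt L S' (zs.flatMap wVar ++ ([Γ'.blank] ++ tail)) [] j [] [] =
        bpSt S' (zs.flatMap wVar ++ ([Γ'.blank] ++ tail)) [] [] [] [] [] [] [] [] [] [] (ticks Γ'.blank j)
          [] [] [] [] := by
      simp [varSt, gtW, gfW, posW, doneW, ruW, cntfW]
    rw [hvar]
    cases i with
    | zero =>
      rw [if_pos rfl]
      have hS0 : S' = S := by
        rw [hS']; exact Function.update_eq_self_iff.2 (by rw [hblk]; rfl)
      rw [hS0]
      simp only [List.take_zero, List.flatMap_nil, List.length_nil, Nat.mul_zero]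
      rw [hwBT]; simp only [List.take_zero, List.flatMap_nil, List.nil_append]
      exact SegRuns.nil (kr KR.btw) bpBody _
    | succ i =>
      rw [if_neg (Nat.succ_ne_zero i)]
      have hne : zsss.take (i + 1) ≠ [] := by
        rw [Ne, List.take_eq_nil_iff]; simp only [Nat.succ_ne_zero, false_or]
        rintro rfl; simp at hi
      have hlen : (zsss.take (i + 1)).length = i + 1 := List.length_take_of_le (by omega)
      have hS1 : S = Function.update S (kr KR.blk) (ticks Γ'.blank (zsss.take (i + 1)).length ++ []) := by
        rw [hlen, List.append_nil]; exact (Function.update_eq_self_iff.2 hblk.symm).symm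
      have := segRuns_bp_skip S L (ticks Γ'.blank j) (zsss.take (i + 1)) [] (zs.flatMap wVar ++ ([Γ'.blank] ++ tail)) hne
      rw [if_pos rfl, ← hS1, ← hS'] at this
      refine this.cast rfl (by rw [hwBT]) rfl le_rfl
  -- the wanted block
  have hvars := segRuns_bp_vars S' L hB' j zs [] ([Γ'.blank] ++ tail)
  rw [List.nil_append] at hvars
  -- its closing blank
  have hn : zs.length = zsss[i].length := by rw [hzs]
  have hblank : Runs (bpBody Γ'.blank)
      (Function.update (varSt L S' ([Γ'.blank] ++ tail) zs j [] []) (kr KR.btw) tail)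
      (bpSt S' tail [Γ'.blank] [] [] [] [] [] [] [] (gtW L zs j) (gfW L zs j) [] [Γ'.blank] (ruW L zs j)
        (cntfW L zs) []) (1 + 2) := by
    unfold varSt
    rw [update_bpSt_btw]
    have hpos : posW zs.length j = [] := by rw [posW, Nat.sub_eq_zero_of_le (by omega), ticks_zero]
    have hdone : doneW zs.length j = [Γ'.blank] := if_pos (by omega)
    rw [hpos, hdone]
    unfold bpBody
    exact Runs.pop_nil (by simp) (Runs.push' (by simp))
  have hkb : varSt L S' ([Γ'.blank] ++ tail) zs j [] [] (kr KR.btw) = Γ'.blank :: tail := by simp [varSt]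
  -- the rest is ignored
  have hign := segRuns_bp_ignore S' [] [] [] [] [] [] [] (gtW L zs j) (gfW L zs j) [] [Γ'.blank] (ruW L zs j)
    (cntfW L zs) tail []
  rw [List.append_nil] at hign
  have hloop := ((hskip.append (hvars.append ((SegRuns.single hkb hblank).append hign))).runs_loop_nil
    (by simp))
  have hclear := runs_clear (kr KR.md2) (bpSt S' [] [Γ'.blank] [] [] [] [] [] [] [] (gtW L zs j) (gfW L zs j)
    [] [Γ'.blank] (ruW L zs j) (cntfW L zs) [])
  rw [bpSt_md2, update_bpSt_md2] at hclear
  unfold blockPass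
  refine (hpre.seq (hloop.seq hclear)).cast rfl rfl ?_
  rw [hwBT]
  simp only [List.length_append, List.length_cons, List.length_nil, bpK]
  ring_nf
  omega

end Literature.Computability.FineGrained.IPRenameM
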